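import Literature.AlgebraicGeometry.Motives.SplitQuadricPointCount
import Literature.AlgebraicGeometry.Motives.ClosedPointsConstantFieldExtension
import Literature.NumberTheory.LFunctions.WeilConjecturesDeligneReductionProofs
import HarnessLib

/-!
# The elliptic quadric `x₀x_{2l+3} + ⋯ + x_l x_{l+3} + x_{l+1}² − ε x_{l+2}² = 0` (`ε` a non-square) in `ℙ^{2l+3}`
# over `𝔽_q`: `#E(𝔽_{q^m}) = Σ_{i=0}^{2l+2} q^{mi} + (−q^{l+1})^m`, `Z(E, T) = 1/(∏ᵢ(1 − qⁱT)·(1 + q^{l+1}T))`,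
# `P_{2l+2} = (1 − q^{l+1}T)(1 + q^{l+1}T)`: a SIMPLE pole at `T = q^{−(l+1)}` that becomes DOUBLE over `𝔽_{q²}`

Topic `Literature/AlgebraicGeometry/Motives`; THEOREMS ONLY (no definition, no instance, no named fact;
D-0026).  The companion of `Motives/SplitQuadricPointCount` (the HYPERBOLIC quadric `ℋ_{2l+3}`: point count
`Σ_{i≤2l+2} Qⁱ + Q^{l+1}`, `P_{2l+2} = (1 − q^{l+1}T)²`, a DOUBLE pole at `q^{−(l+1)}`) and of
`Motives/DiagonalQuadricPointCount` ∕ `DiagonalQuadricTateConjecture` (diagonal quadrics `Σ βᵢxᵢ²`, odd `q`): the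
ELLIPTIC quadric `ℰ_{2l+3} = V₊(Σ_{i ≤ l} xᵢx_{2l+3−i} + x_{l+1}² − ε x_{l+2}²) ⊂ ℙ^{2l+3}` over a finite field `k`
(`q = #k`) with `ε ∈ k` a NON-SQUARE (hence `q` odd; Hirschfeld's canonical form has `f(x_{l+1}, x_{l+2})` an
irreducible binary form — in odd characteristic one may take `x² − εy²`).  Written with the tree's
`SmoothHypersurface.hypersurface` and counted through `SmoothHypersurface.pointCount_mul_sub_one_add_one`
(`#E(𝔽_Q)·(Q−1) + 1 = #{z ∈ 𝔽_Q^{2l+4} : F(z) = 0}`); the form is written inline (no definition).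
-- TODO(general form): characteristic `2` (`x² + xy + cy²`, `c` of absolute trace `1`) is not treated.

## Sources, read on the page

J. W. P. Hirschfeld, *Projective Geometries over Finite Fields* [Hirschfeld1998], §5.2 (held p0103): Thm. 5.2.4 (the
canonical forms `𝒫_{2s}`, `ℋ_{2s−1}`, `ℰ_{2s−1}`), **Lemma 5.2.5** (iii) «`ψ₋(1, q) = 0`», **Theorem 5.2.6** (iii)
«`ψ₋(2s−1, q) = (qˢ + 1)(q^{s−1} − 1)/(q − 1)`» (here `2s − 1 = 2l + 3`), with (ii) `ψ₊` for comparison and the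
Corollary «`ψ(n, q) = (qⁿ − 1)/(q − 1) + (w − 1)q^{(n−1)/2}`» (character `w = 0` for `ℰ`, `w = 2` for `ℋ`).
B. Kahn, *Zeta and L-functions of varieties and motives* [Kahn2020], §6.14 p. 132 (held p0132): Conjecture 6.52
«`ord_{s=i} ζ(X, s) = −rg A^i_num(X)`» and the statements `T^i`, `S^i`.
A. Weil, *Numbers of solutions of equations in finite fields* [Weil1949], p. 507 (held p0011): the shape of `Z(U)`,
«the `α_{hi}` are algebraic integers of absolute value `q^{h/2}`».
J. Tate, *Algebraic cycles and poles of zeta functions* [TateWoodsHole1965], §3 (the order of the pole of `Z(X, T)` at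
`T = q^{−r}` and the rank of the algebraic `r`-cycles rational over `𝔽_q`).
R. Lidl, H. Niederreiter, *Finite Fields* [LidlNiederreiter1996], Thm. 2.5–2.6 (the subfields `𝔽_{q^m}`; Euler's
criterion `a^{(q−1)/2} = ±1`).  H. Stichtenoth [Stichtenoth2009], Thm. 5.1.15 (f) (`Z_r(t)`, the zeta function over
the constant field extension of degree `r`: the tree's `zetaSeriesPow`).
K. Ireland, M. Rosen [IrelandRosen1982], Ch. 10 §3 and Ex. 4 (projective versus affine counts; the kernel of a linear
form).

## What is here (`Q = #L` resp. `q^m`; `N₀ = #{Σ_{i≤l} uᵢvᵢ = 0}`, `N₁ = #{Σ uᵢvᵢ = 1}` in `L^{l+1} × L^{l+1}`)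

* §1 (pure counting over a finite field `L`): `natCard_linearForm_eq_zero` (the kernel of a non-zero linear form
  on `L^p` has `Q^{p−1}` elements, rank–nullity), **`natCard_pairing_eq_zero`** (`N₀ = Q^p + (Q^p − 1)Q^{p−1}`),
  **`natCard_pairing_eq_zero_add`** (`N₀ + (Q−1)N₁ = Q^{2p}`: the non-zero fibres of `(u,v) ↦ Σ uᵢvᵢ` are
  equinumerous), **`natCard_sq_sub_mul_sq_eq_zero_of_not_isSquare`** (`#{x² = εy²} = 1` for `ε` a non-square)
  and `natCard_sq_sub_sq_mul_sq_eq_zero` (`#{x² = δ²y²} = 2Q − 1`, two lines, `char ≠ 2`).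
* §2 **`FiniteField.isSquare_algebraMap_iff_even_finrank`**: a non-square `ε ∈ k` becomes a square in the finite
  extension `L ⊇ k` iff `[L : k]` is even (Euler's criterion in `k` and `L`, `(#L−1)/2 = (q−1)/2·(1 + q + ⋯ + q^{m−1})`).
* §3 the hypersurface: `EllipticQuadric.isHomogeneous`, `.aeval_eq`, **`.natCard_cone_add`** (the cone fibred over
  the two middle coordinates: `#{F = 0} + n₀N₁ = n₀N₀ + Q²N₁`, `n₀ = #{x² − εy² = 0}`).
* §4 point counts and zeta (`ε` a non-square in `k`): the raw counts `…_mul_sub_one_add_of_odd ∕ _of_even`,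
  **`pointCount_ellipticQuadric_add_of_odd`** (Hirschfeld 5.2.6 (iii): `#E(𝔽_{q^m}) + q^{m(l+1)} = Σ_{i≤2l+2} q^{mi}`,
  `m` odd), **`pointCount_ellipticQuadric_of_even`** (`= Σ q^{mi} + q^{m(l+1)}`, `m` even: over `𝔽_{q^m}` the quadric
  is hyperbolic), **`pointCount_ellipticQuadric_cast`** (`#E(𝔽_{q^m}) = Σ_{i≤2l+2} q^{mi} + (−q^{l+1})^m` in `ℤ`, all
  `m ≥ 1`), `pointCount_ellipticQuadric_one_mul_sub_one` (Hirschfeld's display `·(q−1) = (q^{l+1}−1)(q^{l+2}+1)`),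
  the ovoid `pointCount_ellipticQuadric_surface_of_odd` (`l = 0`: `Q² + 1`) ∕ `_of_even` (`(Q+1)²`), and
  **`zetaSeries_ellipticQuadric_mul_prod`** (`Z(E,T)·∏_{i≤2l+2}(1 − qⁱT)·(1 + q^{l+1}T) = 1`).
* §5 (pure algebra, `Kahn2003` namespace) `HasPoleOfOrderAt.of_mul_coe` and
  **`hasPoleOfOrderAt_of_mul_prod_pow_eq_one`**: a zeta function of Tate type `Z = 1/∏ᵢ(1 − q^{aᵢ}T)^{cᵢ}` (`q > 1`)
  has at `T = q^{−r}` a pole of order EXACTLY `Σ_{aᵢ = r} cᵢ`.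
* §6 **`isWeilFactorization_ellipticQuadric`** (dimension `2l+2`: `P_{2r} = 1 − qʳT` for `r ≠ l+1`,
  **`P_{2l+2} = 1 − q^{2l+2}T² = (1 − q^{l+1}T)(1 + q^{l+1}T)`**, RH: `|±q^{−(l+1)}| = q^{−(2l+2)/2}`), uniqueness
  `IsWeilFactorization.eq_of_ellipticQuadric`, the Betti numbers `….natDegree_eq_of_ellipticQuadric` (`b_{2l+2} = 2`,
  `_middle`), and **`hasPoleOfOrderAt_zetaSeries_ellipticQuadric`**: EVERY pole of `Z(E, T)` at `q^{−r}`,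
  `r ≤ 2l+2`, is SIMPLE — in the middle too (`_middle`): over `𝔽_q` the rank of the `(l+1)`-cycles is `1`
  although `b_{2l+2} = 2` (the second inverse root is `−q^{l+1}`).
* §7 base change to `𝔽_{q²}` (the tree's `zetaSeriesPow E 2`): **`zetaSeriesPow_ellipticQuadric_two_mul_prod`**
  (`Z(E ⊗ 𝔽_{q²}, T)·∏(1 − q^{2i}T)·(1 − q^{2(l+1)}T) = 1`), `zetaSeriesPow_ellipticQuadric_two_eq_splitQuadric`
  (`= Z(H ⊗ 𝔽_{q²}, T)` for the hyperbolic quadric `H` of `SplitQuadricPointCount`), and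
  **`hasPoleOfOrderAt_zetaSeriesPow_ellipticQuadric_two_middle`**: over `𝔽_{q²}` the middle pole is DOUBLE (order
  exactly `2` at `(q²)^{−(l+1)}`; `_of_ne`: the others stay simple) — the standard example of algebraic (Tate) classes
  that only become rational after a quadratic extension.

What is NOT here: characteristic `2`; `E`-valued (cohomological) statements; the isomorphism `E ⊗ 𝔽_{q²} ≅ H ⊗ 𝔽_{q²}`
of schemes.  HC is not touched.

## References

* [Hirschfeld1998] J. W. P. Hirschfeld, *Projective Geometries over Finite Fields*, 2nd ed., OUP (1998), §5.2
  Thm. 5.2.4, Lemma 5.2.5, Thm. 5.2.6 and Corollary.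
* [Weil1949] A. Weil, *Numbers of solutions of equations in finite fields*, Bull. AMS 55 (1949), p. 507.
* [Kahn2020] B. Kahn, *Zeta and L-functions of varieties and motives*, LMS LNS 462 (2020), §6.14 Conj. 6.52.
* [TateWoodsHole1965] J. Tate, *Algebraic cycles and poles of zeta functions* (1965), §3.
* [LidlNiederreiter1996] R. Lidl, H. Niederreiter, *Finite Fields*, 2nd ed. (1996), Thm. 2.5, Thm. 2.6.
* [Stichtenoth2009] H. Stichtenoth, *Algebraic Function Fields and Codes*, 2nd ed. (2009), Thm. 5.1.15 (f).
* [IrelandRosen1982] K. Ireland, M. Rosen, *A Classical Introduction to Modern Number Theory* (1982), Ch. 10 §3, Ex. 4.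
* [Deligne1974] P. Deligne, *La conjecture de Weil. I*, Publ. Math. IHÉS 43 (1974), Th. (1.6).
* [Milne2012AddendumZetaValues] J. S. Milne, *Values of zeta functions … (addendum)*, §0.4.

## Provenance

Lane `lit-hodgefound` (summit `HodgeConjecture`, Track 2 foundations library, Layer B: motives / zeta functions /
Tate conjecture), seat `lit-hodgefound-p29` (literature-prover, generation 51, row g51-#11).
-/

universe u

open Finset
open Literature.NumberTheory.LFunctions.Dwork (countZeta countZeta_congr countZeta_pow_mul countZeta_sum
  countZeta_add zetaSeries_eq_countZeta)
open Literature.AlgebraicGeometry.Kahn2003 (HasPoleOfOrderAt)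

noncomputable section

namespace Literature.AlgebraicGeometry.Motives

/-! ### §1 Counting: `Σᵢ uᵢvᵢ = c` and `x² − εy² = 0` over a finite field `L` -/

section Counting

variable (L : Type u) [Field L] [Finite L] {p : ℕ}

omit [Finite L] in
/-- **The kernel of a non-zero linear form on `L^p` has `Q^{p−1}` elements** (`Q = #L`): rank–nullity.
[cite: IrelandRosen1982, Ch. 10 Ex. 4] -/
theorem natCard_linearForm_eq_zero (a : Fin p → L) (ha : a ≠ 0) :
    Nat.card {v : Fin p → L // ∑ i, a i * v i = 0} = Nat.card L ^ (p - 1) := by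
  classical
  obtain ⟨j, hj⟩ := Function.ne_iff.mp ha
  -- the linear form
  let φ : (Fin p → L) →ₗ[L] L :=
    { toFun := fun v => ∑ i, a i * v i
      map_add' := fun v w => by simp only [Pi.add_apply, mul_add, sum_add_distrib]
      map_smul' := fun c v => by simp only [Pi.smul_apply, smul_eq_mul, mul_sum, mul_left_comm, RingHom.id_apply] }
  have hφ : ∀ v, φ v = ∑ i, a i * v i := fun v => rfl
  -- it is surjective: `φ (c/aⱼ · eⱼ) = c`
  have hsurj : Function.Surjective φ := fun c => ⟨Pi.single j (c / a j), by
    rw [hφ, Finset.sum_eq_single j (fun i _ hij => by rw [Pi.single_eq_of_ne hij, mul_zero])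
      (fun h => absurd (mem_univ j) h), Pi.single_eq_same, mul_div_cancel₀ _ hj]⟩
  have hrank := LinearMap.finrank_range_add_finrank_ker φ
  rw [LinearMap.range_eq_top.mpr hsurj, finrank_top, Module.finrank_self, Module.finrank_fin_fun] at hrank
  have hker : Module.finrank L (LinearMap.ker φ) = p - 1 := by omega
  rw [Nat.card_congr (Equiv.subtypeEquivRight (fun v => (LinearMap.mem_ker (f := φ)).symm) :
      {v : Fin p → L // ∑ i, a i * v i = 0} ≃ LinearMap.ker φ),
    Module.natCard_eq_pow_finrank (K := L) (V := LinearMap.ker φ), hker]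

/-- **`N₀ = #{(u, v) ∈ L^p × L^p : Σᵢ uᵢvᵢ = 0} = Q^p + (Q^p − 1)·Q^{p−1}`**: for `u = 0` every `v`, for each
`u ≠ 0` the kernel of a non-zero linear form. [cite: Hirschfeld1998, §5.2 Thm. 5.2.6] [cite: IrelandRosen1982, Ch. 10 Ex. 4] -/
theorem natCard_pairing_eq_zero (p : ℕ) :
    Nat.card {w : (Fin p → L) × (Fin p → L) // ∑ i, w.1 i * w.2 i = 0} =
      Nat.card L ^ p + (Nat.card L ^ p - 1) * Nat.card L ^ (p - 1) := by
  classical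
  letI := Fintype.ofFinite L
  have hfib : ∀ u : Fin p → L,
      Nat.card {v : Fin p → L // ∑ i, u i * v i = 0} = if u = 0 then Nat.card L ^ p else Nat.card L ^ (p - 1) := by
    intro u
    split_ifs with hu
    · subst hu
      rw [Nat.card_congr (Equiv.subtypeUnivEquiv fun v => by simp), Nat.card_fun, Nat.card_fin]
    · exact natCard_linearForm_eq_zero L u hu
  rw [Nat.card_congr (Equiv.subtypeProdEquivSigmaSubtype fun (u v : Fin p → L) => ∑ i, u i * v i = 0),
    Nat.card_sigma]
  simp_rw [hfib]
  rw [Finset.sum_ite, Finset.sum_const, Finset.sum_const, smul_eq_mul, smul_eq_mul,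
    Finset.filter_eq' (univ : Finset (Fin p → L)) (0 : Fin p → L), if_pos (mem_univ _), card_singleton, one_mul,
    Finset.filter_ne' univ (0 : Fin p → L), card_erase_of_mem (mem_univ _), card_univ, Fintype.card_fun,
    Fintype.card_fin, ← Nat.card_eq_fintype_card]

omit [Finite L] in
/-- The fibres `Σᵢ uᵢvᵢ = c` over the non-zero values are equinumerous (`u ↦ c⁻¹u`). [folklore] -/
private theorem natCard_pairing_eq_const {c : L} (hc : c ≠ 0) :
    Nat.card {w : (Fin p → L) × (Fin p → L) // ∑ i, w.1 i * w.2 i = c} =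
      Nat.card {w : (Fin p → L) × (Fin p → L) // ∑ i, w.1 i * w.2 i = 1} := by
  refine Nat.card_congr
    { toFun := fun w => ⟨(c⁻¹ • w.1.1, w.1.2), ?_⟩
      invFun := fun w => ⟨(c • w.1.1, w.1.2), ?_⟩
      left_inv := fun w => by
        ext i <;> simp only [Pi.smul_apply, smul_eq_mul]
        · rw [← mul_assoc, mul_inv_cancel₀ hc, one_mul]
      right_inv := fun w => by
        ext i <;> simp only [Pi.smul_apply, smul_eq_mul]
        · rw [← mul_assoc, inv_mul_cancel₀ hc, one_mul] }
  · have h := w.2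
    simp only [Pi.smul_apply, smul_eq_mul, mul_assoc, ← Finset.mul_sum] at h ⊢
    rw [h, inv_mul_cancel₀ hc]
  · have h := w.2
    simp only [Pi.smul_apply, smul_eq_mul, mul_assoc, ← Finset.mul_sum] at h ⊢
    rw [h, mul_one]

/-- **`N₀ + (Q − 1)·N₁ = Q^{2p}`**, `N₁ = #{Σᵢ uᵢvᵢ = 1}`: the fibres of `(u, v) ↦ Σᵢ uᵢvᵢ` partition
`L^p × L^p`, and the `Q − 1` fibres over non-zero values are equinumerous. [cite: Hirschfeld1998, §5.2 Thm. 5.2.6] -/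
theorem natCard_pairing_eq_zero_add :
    Nat.card {w : (Fin p → L) × (Fin p → L) // ∑ i, w.1 i * w.2 i = 0} +
      (Nat.card L - 1) * Nat.card {w : (Fin p → L) × (Fin p → L) // ∑ i, w.1 i * w.2 i = 1} =
        Nat.card L ^ (2 * p) := by
  classical
  letI := Fintype.ofFinite L
  have htot : Nat.card ((Fin p → L) × (Fin p → L)) =
      ∑ c : L, Nat.card {w : (Fin p → L) × (Fin p → L) // ∑ i, w.1 i * w.2 i = c} := by
    rw [← Nat.card_sigma, Nat.card_congr (Equiv.sigmaFiberEquiv fun w : (Fin p → L) × (Fin p → L) =>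
      ∑ i, w.1 i * w.2 i)]
  rw [Nat.card_prod, Nat.card_fun, Nat.card_fin, ← pow_add, show p + p = 2 * p by ring,
    ← Finset.add_sum_erase _ _ (mem_univ (0 : L))] at htot
  rw [htot, Finset.sum_congr rfl fun c hc => natCard_pairing_eq_const L (p := p) (Finset.ne_of_mem_erase hc),
    Finset.sum_const, smul_eq_mul, card_erase_of_mem (mem_univ _), card_univ, ← Nat.card_eq_fintype_card]

omit [Finite L] in
/-- `a = −a` forces `a = 0` in characteristic `≠ 2` (private). [folklore] -/
private theorem eq_zero_of_eq_neg_self (hL : ringChar L ≠ 2) {a : L} (h : a = -a) : a = 0 := by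
  have h2 : (2 : L) * a = 0 := by rw [two_mul]; exact eq_neg_iff_add_eq_zero.mp h
  exact (mul_eq_zero.mp h2).resolve_left (Ring.two_ne_zero hL)

/-- **`x² − εy² = 0` has only the trivial solution when `ε` is not a square in `L`**:
`#{(x, y) ∈ L² : x² = εy²} = 1`. [cite: Hirschfeld1998, §5.2 Lemma 5.2.5 (iii)] -/
theorem natCard_sq_sub_mul_sq_eq_zero_of_not_isSquare {ε : L} (hε : ¬IsSquare ε) :
    Nat.card {t : L × L // t.1 ^ 2 - ε * t.2 ^ 2 = 0} = 1 := by
  classical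
  letI := Fintype.ofFinite L
  have hε0 : ε ≠ 0 := fun h => hε (h ▸ IsSquare.zero)
  have hfib : ∀ x : L, Nat.card {y : L // x ^ 2 - ε * y ^ 2 = 0} = if x = 0 then 1 else 0 := by
    intro x
    rw [Nat.card_eq_fintype_card, Fintype.card_subtype]
    split_ifs with hx
    · subst hx
      rw [show (univ.filter fun y : L => (0 : L) ^ 2 - ε * y ^ 2 = 0) = {0} from ?_, card_singleton]
      ext y
      simp only [mem_filter, mem_univ, true_and, mem_singleton, zero_pow two_ne_zero, zero_sub, neg_eq_zero,
        mul_eq_zero, hε0, false_or, pow_eq_zero_iff two_ne_zero]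
    · rw [Finset.card_eq_zero, Finset.filter_eq_empty_iff]
      intro y _ hy
      rw [sub_eq_zero] at hy
      have hy0 : y ≠ 0 := by
        rintro rfl
        rw [zero_pow two_ne_zero, mul_zero, pow_eq_zero_iff two_ne_zero] at hy
        exact hx hy
      exact hε ⟨x * y⁻¹, by
        field_simp
        linear_combination -hy⟩
  rw [Nat.card_congr (Equiv.subtypeProdEquivSigmaSubtype fun (x y : L) => x ^ 2 - ε * y ^ 2 = 0), Nat.card_sigma]
  simp_rw [hfib]
  rw [Finset.sum_ite_eq' univ (0 : L), if_pos (mem_univ _)]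

/-- **`x² − δ²y² = 0` is a pair of distinct lines when `δ ≠ 0` and the characteristic is odd**:
`#{(x, y) ∈ L² : x² = δ²y²} = 2Q − 1`. [cite: Hirschfeld1998, §5.2 Lemma 5.2.5 (ii)] -/
theorem natCard_sq_sub_sq_mul_sq_eq_zero (hL : ringChar L ≠ 2) {δ : L} (hδ : δ ≠ 0) :
    Nat.card {t : L × L // t.1 ^ 2 - δ ^ 2 * t.2 ^ 2 = 0} = 2 * Nat.card L - 1 := by
  classical
  letI := Fintype.ofFinite L
  have hfib : ∀ x : L, Nat.card {y : L // x ^ 2 - δ ^ 2 * y ^ 2 = 0} = if x = 0 then 1 else 2 := by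
    intro x
    rw [Nat.card_eq_fintype_card, Fintype.card_subtype]
    split_ifs with hx
    · subst hx
      rw [show (univ.filter fun y : L => (0 : L) ^ 2 - δ ^ 2 * y ^ 2 = 0) = {0} from ?_, card_singleton]
      ext y
      simp only [mem_filter, mem_univ, true_and, mem_singleton, zero_pow two_ne_zero, zero_sub, neg_eq_zero,
        mul_eq_zero, pow_eq_zero_iff two_ne_zero, hδ, false_or]
    · have hne : x * δ⁻¹ ≠ -(x * δ⁻¹) := fun h =>
        (mul_ne_zero hx (inv_ne_zero hδ)) (eq_zero_of_eq_neg_self L hL h)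
      rw [show (univ.filter fun y : L => x ^ 2 - δ ^ 2 * y ^ 2 = 0) = {x * δ⁻¹, -(x * δ⁻¹)} from ?_,
        card_pair hne]
      ext y
      simp only [mem_filter, mem_univ, true_and, mem_insert, mem_singleton]
      rw [sub_eq_zero, ← mul_pow, eq_comm, sq_eq_sq_iff_eq_or_eq_neg]
      constructor
      · rintro (h | h)
        · left; rw [← h, mul_comm δ y, mul_assoc, mul_inv_cancel₀ hδ, mul_one]
        · right
          have hx' : x = -(δ * y) := by rw [h, neg_neg]
          rw [hx', neg_mul, neg_neg, mul_comm δ y, mul_assoc, mul_inv_cancel₀ hδ, mul_one]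
      · rintro (h | h)
        · left; rw [h, mul_comm δ, mul_assoc, inv_mul_cancel₀ hδ, mul_one]
        · right; rw [h, mul_neg, mul_comm δ, mul_assoc, inv_mul_cancel₀ hδ, mul_one]
  rw [Nat.card_congr (Equiv.subtypeProdEquivSigmaSubtype fun (x y : L) => x ^ 2 - δ ^ 2 * y ^ 2 = 0),
    Nat.card_sigma]
  simp_rw [hfib]
  rw [Finset.sum_ite, Finset.sum_const, Finset.sum_const, smul_eq_mul, smul_eq_mul,
    Finset.filter_eq' univ (0 : L), if_pos (mem_univ _), card_singleton, Finset.filter_ne' univ (0 : L),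
    card_erase_of_mem (mem_univ _), card_univ, ← Nat.card_eq_fintype_card]
  have h1 : 1 ≤ Nat.card L := Nat.card_pos
  omega

end Counting

/-! ### §2 A non-square of `𝔽_q` is a square in `𝔽_{q^m}` iff `m` is even -/

section SquareCriterion

/-- `(−1)^{1 + q + ⋯ + q^{m−1}} = (−1)^m` for `q` odd. [folklore] -/
private theorem neg_one_pow_geom_sum {R : Type*} [Monoid R] [HasDistribNeg R] {q : ℕ} (hq : Odd q) (m : ℕ) :
    (-1 : R) ^ (∑ j ∈ range m, q ^ j) = (-1) ^ m := by
  induction m with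
  | zero => rw [sum_range_zero]
  | succ m ih => rw [sum_range_succ, pow_add, ih, (hq.pow).neg_one_pow, pow_succ]

/-- **A non-square `ε` of the finite field `k` becomes a square in the finite extension `L ⊇ k` iff `[L : k]` is
even** (Euler's criterion in `k` and in `L`: `ε^{(q−1)/2} = −1` and `(#L − 1)/2 = (q−1)/2 · (1 + q + ⋯ + q^{m−1})`,
so `ε^{(#L−1)/2} = (−1)^m`). [cite: LidlNiederreiter1996, Thm. 2.5 and Thm. 2.6] [cite: IrelandRosen1982, Ch. 7 §1] -/
theorem FiniteField.isSquare_algebraMap_iff_even_finrank {k : Type*} [Field k] [Finite k] {L : Type*} [Field L]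
    [Finite L] [Algebra k L] {ε : k} (hε : ¬IsSquare ε) :
    IsSquare (algebraMap k L ε) ↔ Even (Module.finrank k L) := by
  classical
  letI := Fintype.ofFinite k
  letI := Fintype.ofFinite L
  haveI : Module.Finite k L := Module.Finite.of_finite
  have hk2 : ringChar k ≠ 2 := fun h => hε (FiniteField.isSquare_of_char_two h ε)
  have hL2 : ringChar L ≠ 2 := by rwa [← Algebra.ringChar_eq k L]
  have hε0 : ε ≠ 0 := fun h => hε (h ▸ IsSquare.zero)
  have hεL0 : algebraMap k L ε ≠ 0 := (map_ne_zero _).mpr hε0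
  have hk : ε ^ (Fintype.card k / 2) = -1 :=
    (FiniteField.pow_dichotomy hk2 hε0).resolve_left fun h1 => hε ((FiniteField.isSquare_iff hk2 hε0).mpr h1)
  set q := Fintype.card k with hq
  set m := Module.finrank k L with hm
  have hQ : Fintype.card L = q ^ m := Module.card_eq_pow_finrank (K := k) (V := L)
  have hqodd : q % 2 = 1 := FiniteField.odd_card_of_char_ne_two hk2
  have hQodd : Fintype.card L % 2 = 1 := FiniteField.odd_card_of_char_ne_two hL2
  -- `(#L − 1)/2 = (q − 1)/2 · Σ_{j<m} qʲ`
  have h1q : 1 ≤ q := Fintype.card_pos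
  have hgeom : (∑ j ∈ range m, q ^ j) * (q - 1) = q ^ m - 1 := geom_sum_mul_of_one_le h1q m
  have hdiv : Fintype.card L / 2 = q / 2 * ∑ j ∈ range m, q ^ j := by
    apply Nat.eq_of_mul_eq_mul_left two_pos
    rw [Nat.two_mul_odd_div_two hQodd, ← mul_assoc, Nat.two_mul_odd_div_two hqodd, hQ, ← hgeom, mul_comm]
  rw [FiniteField.isSquare_iff hL2 hεL0, hdiv, pow_mul, ← map_pow, hk, map_neg, map_one,
    neg_one_pow_geom_sum (Nat.odd_iff.mpr hqodd), neg_one_pow_eq_one_iff_even (Ring.neg_one_ne_one_of_char_ne_two hL2)]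

end SquareCriterion

/-! ### §3 The elliptic quadric as a hypersurface and its affine cone -/

namespace EllipticQuadric

open _root_.MvPolynomial

section Form

variable {k : Type u} [Field k] (l : ℕ) (ε : k)

/-- `l + 1 ≤ 2l + 2 + 2`: the hyperbolic pairs occupy the first `l + 1` coordinates (and their mirrors). [folklore] -/
private theorem le₁ (l : ℕ) : l + 1 ≤ 2 * l + 2 + 2 := by omega

/-- The two middle coordinates `l + 1`, `l + 2`. [folklore] -/
private theorem lt₁ (l : ℕ) : l + 1 < 2 * l + 2 + 2 := by omega

/-- The two middle coordinates `l + 1`, `l + 2`. [folklore] -/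
private theorem lt₂ (l : ℕ) : l + 2 < 2 * l + 2 + 2 := by omega

/-- The elliptic form `Σ_{i ≤ l} xᵢx_{2l+3−i} + x_{l+1}² − ε x_{l+2}²` is homogeneous of degree `2`.
[cite: Hirschfeld1998, §5.2 Thm. 5.2.4] -/
theorem isHomogeneous :
    ((∑ i : Fin (l + 1), X (Fin.castLE (le₁ l) i) * X (Fin.rev (Fin.castLE (le₁ l) i))) +
        X ⟨l + 1, lt₁ l⟩ ^ 2 - C ε * X ⟨l + 2, lt₂ l⟩ ^ 2 : MvPolynomial (Fin (2 * l + 2 + 2)) k).IsHomogeneous 2 := by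
  refine ((IsHomogeneous.sum _ _ 2 fun i _ => ?_).add (isHomogeneous_X_pow _ 2)).sub
    ((isHomogeneous_X_pow _ 2).C_mul ε)
  exact (isHomogeneous_X k (Fin.castLE (le₁ l) i)).mul (isHomogeneous_X k (Fin.rev (Fin.castLE (le₁ l) i)))

/-- Evaluation of the elliptic form: `F(z) = Σ_{i ≤ l} z_i z_{2l+3−i} + z_{l+1}² − ε z_{l+2}²`.
[cite: Hirschfeld1998, §5.2 Thm. 5.2.4] -/
theorem aeval_eq {A : Type*} [CommRing A] [Algebra k A] (z : Fin (2 * l + 2 + 2) → A) :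
    aeval z ((∑ i : Fin (l + 1), X (Fin.castLE (le₁ l) i) * X (Fin.rev (Fin.castLE (le₁ l) i))) +
        X ⟨l + 1, lt₁ l⟩ ^ 2 - C ε * X ⟨l + 2, lt₂ l⟩ ^ 2 : MvPolynomial (Fin (2 * l + 2 + 2)) k) =
      (∑ i : Fin (l + 1), z (Fin.castLE (le₁ l) i) * z (Fin.rev (Fin.castLE (le₁ l) i))) +
        z ⟨l + 1, lt₁ l⟩ ^ 2 - algebraMap k A ε * z ⟨l + 2, lt₂ l⟩ ^ 2 := by
  simp only [map_add, map_sub, map_sum, map_mul, map_pow, aeval_X, aeval_C]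

end Form

section Cone

variable {k : Type u} [Field k] (l : ℕ) (ε : k) (L : Type u) [Field L] [Algebra k L]

/-- **The affine cone of the elliptic quadric, fibred over the two middle coordinates**:
`#{z ∈ L^{2l+4} : F(z) = 0} + n₀·N₁ = n₀·N₀ + Q²·N₁`, where `n₀ = #{(x, y) : x² − εy² = 0}`,
`N₀ = #{Σ_{i≤l} uᵢvᵢ = 0}`, `N₁ = #{Σ_{i≤l} uᵢvᵢ = 1}` (the fibre over `(x, y)` is `{Σ uᵢvᵢ = −(x² − εy²)}`, of size
`N₀` or `N₁`). [cite: Hirschfeld1998, §5.2 Thm. 5.2.6 (proof, (5.2))] -/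
theorem natCard_cone_add [Finite L] :
    Nat.card {z : Fin (2 * l + 2 + 2) → L //
        aeval z ((∑ i : Fin (l + 1), X (Fin.castLE (le₁ l) i) * X (Fin.rev (Fin.castLE (le₁ l) i))) +
          X ⟨l + 1, lt₁ l⟩ ^ 2 - C ε * X ⟨l + 2, lt₂ l⟩ ^ 2 : MvPolynomial (Fin (2 * l + 2 + 2)) k) = 0} +
      Nat.card {t : L × L // t.1 ^ 2 - algebraMap k L ε * t.2 ^ 2 = 0} *
        Nat.card {w : (Fin (l + 1) → L) × (Fin (l + 1) → L) // ∑ i, w.1 i * w.2 i = 1} =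
      Nat.card {t : L × L // t.1 ^ 2 - algebraMap k L ε * t.2 ^ 2 = 0} *
          Nat.card {w : (Fin (l + 1) → L) × (Fin (l + 1) → L) // ∑ i, w.1 i * w.2 i = 0} +
        Nat.card L ^ 2 * Nat.card {w : (Fin (l + 1) → L) × (Fin (l + 1) → L) // ∑ i, w.1 i * w.2 i = 1} := by
  classical
  letI := Fintype.ofFinite L
  -- index bookkeeping
  have hlt : ∀ i : Fin (l + 1), ((Fin.castLE (le₁ l) i : Fin (2 * l + 2 + 2)) : ℕ) < l + 1 := fun i => by
    simp only [Fin.val_castLE]; exact i.2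
  have hrev : ∀ i : Fin (l + 1), ((Fin.rev (Fin.castLE (le₁ l) i) : Fin (2 * l + 2 + 2)) : ℕ) = 2 * l + 3 - i :=
    fun i => by simp only [Fin.val_rev, Fin.val_castLE]; omega
  -- the coordinate split `z ↦ ((z_{l+1}, z_{l+2}), ((z_i)_{i ≤ l}, (z_{2l+3−i})_{i ≤ l}))`
  let e : (Fin (2 * l + 2 + 2) → L) ≃ (L × L) × ((Fin (l + 1) → L) × (Fin (l + 1) → L)) :=
    { toFun := fun z => ((z ⟨l + 1, lt₁ l⟩, z ⟨l + 2, lt₂ l⟩),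
        (fun i => z (Fin.castLE (le₁ l) i), fun i => z (Fin.rev (Fin.castLE (le₁ l) i))))
      invFun := fun t j =>
        if h : (j : ℕ) < l + 1 then t.2.1 ⟨j, h⟩
        else if h₁ : (j : ℕ) = l + 1 then t.1.1
        else if h₂ : (j : ℕ) = l + 2 then t.1.2
        else t.2.2 ⟨2 * l + 3 - j, by omega⟩
      left_inv := fun z => by
        funext j
        by_cases h : (j : ℕ) < l + 1
        · simp only [dif_pos h]
          exact congrArg z (Fin.ext rfl)
        · simp only [dif_neg h]
          by_cases h1 : (j : ℕ) = l + 1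
          · rw [dif_pos h1]; exact congrArg z (Fin.ext h1.symm)
          · rw [dif_neg h1]
            by_cases h2 : (j : ℕ) = l + 2
            · rw [dif_pos h2]; exact congrArg z (Fin.ext h2.symm)
            · rw [dif_neg h2]
              exact congrArg z (Fin.ext (by simp only [Fin.val_rev, Fin.val_castLE]; omega))
      right_inv := fun t => by
        refine Prod.ext (Prod.ext ?_ ?_) (Prod.ext (funext fun i => ?_) (funext fun i => ?_))
        · simp
        · simp
        · simp only [dif_pos (hlt i)]
          exact congrArg t.2.1 (Fin.ext rfl)
        · have h1 : ¬ ((Fin.rev (Fin.castLE (le₁ l) i) : Fin (2 * l + 2 + 2)) : ℕ) < l + 1 := by rw [hrev]; omega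
          have h2 : ¬ ((Fin.rev (Fin.castLE (le₁ l) i) : Fin (2 * l + 2 + 2)) : ℕ) = l + 1 := by rw [hrev]; omega
          have h3 : ¬ ((Fin.rev (Fin.castLE (le₁ l) i) : Fin (2 * l + 2 + 2)) : ℕ) = l + 2 := by rw [hrev]; omega
          simp only [dif_neg h1, dif_neg h2, dif_neg h3]
          exact congrArg t.2.2 (Fin.ext (by simp only [Fin.val_rev, Fin.val_castLE]; omega)) }
  -- transport the cone along `e` and fibre over the middle coordinates
  set N₀ := Nat.card {w : (Fin (l + 1) → L) × (Fin (l + 1) → L) // ∑ i, w.1 i * w.2 i = 0} with hN₀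
  set N₁ := Nat.card {w : (Fin (l + 1) → L) × (Fin (l + 1) → L) // ∑ i, w.1 i * w.2 i = 1} with hN₁
  have hcone₁ : Nat.card {z : Fin (2 * l + 2 + 2) → L //
      aeval z ((∑ i : Fin (l + 1), X (Fin.castLE (le₁ l) i) * X (Fin.rev (Fin.castLE (le₁ l) i))) +
        X ⟨l + 1, lt₁ l⟩ ^ 2 - C ε * X ⟨l + 2, lt₂ l⟩ ^ 2 : MvPolynomial (Fin (2 * l + 2 + 2)) k) = 0} =
      Nat.card {c : (L × L) × ((Fin (l + 1) → L) × (Fin (l + 1) → L)) //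
        ∑ i, c.2.1 i * c.2.2 i + c.1.1 ^ 2 - algebraMap k L ε * c.1.2 ^ 2 = 0} :=
    Nat.card_congr (e.subtypeEquiv fun z => by simp only [aeval_eq]; rfl)
  have hcone : Nat.card {z : Fin (2 * l + 2 + 2) → L //
      aeval z ((∑ i : Fin (l + 1), X (Fin.castLE (le₁ l) i) * X (Fin.rev (Fin.castLE (le₁ l) i))) +
        X ⟨l + 1, lt₁ l⟩ ^ 2 - C ε * X ⟨l + 2, lt₂ l⟩ ^ 2 : MvPolynomial (Fin (2 * l + 2 + 2)) k) = 0} =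
      ∑ t : L × L, if t.1 ^ 2 - algebraMap k L ε * t.2 ^ 2 = 0 then N₀ else N₁ := by
    rw [hcone₁, Nat.card_congr (Equiv.subtypeProdEquivSigmaSubtype fun (t : L × L)
        (w : (Fin (l + 1) → L) × (Fin (l + 1) → L)) => ∑ i, w.1 i * w.2 i + t.1 ^ 2 - algebraMap k L ε * t.2 ^ 2 = 0),
      Nat.card_sigma]
    refine Finset.sum_congr rfl fun t _ => ?_
    split_ifs with ht
    · rw [hN₀]
      exact Nat.card_congr (Equiv.subtypeEquivRight fun w => by rw [add_sub_assoc, ht, add_zero])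
    · rw [hN₁, ← natCard_pairing_eq_const L (neg_ne_zero.mpr ht)]
      exact Nat.card_congr (Equiv.subtypeEquivRight fun w => by rw [add_sub_assoc, add_eq_zero_iff_eq_neg])
  rw [hcone, Finset.sum_ite, Finset.sum_const, Finset.sum_const, smul_eq_mul, smul_eq_mul]
  have hsplit := Finset.card_filter_add_card_filter_not
    (s := (univ : Finset (L × L))) (fun t : L × L => t.1 ^ 2 - algebraMap k L ε * t.2 ^ 2 = 0)
  rw [card_univ, Fintype.card_prod, ← Nat.card_eq_fintype_card, ← pow_two] at hsplit
  rw [Nat.card_eq_fintype_card (α := {t : L × L // t.1 ^ 2 - algebraMap k L ε * t.2 ^ 2 = 0}),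
    Fintype.card_subtype, ← hsplit]
  ring

end Cone

end EllipticQuadric

/-! ### §4 Point counts: Hirschfeld's `ψ₋(2s−1, q)` and its even-degree companions -/

section PointCount

open _root_.MvPolynomial
open SmoothHypersurface (hypersurface)
open EllipticQuadric

variable {k : Type u} [Field k] [Finite k] (l : ℕ) {ε : k}

/-- The raw count over `𝔽_{q^m}`, `m` ODD (so `ε` stays a non-square in `𝔽_{q^m}`): with `Q = q^m`,
`#E(𝔽_Q)·(Q − 1) + 1 + Q^{l+2} = Q^{2l+3} + Q^{l+1}`. [cite: Hirschfeld1998, §5.2 Thm. 5.2.6 (iii)] -/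
theorem pointCount_ellipticQuadric_mul_sub_one_add_of_odd (hε : ¬IsSquare ε) {m : ℕ} (hm : 0 < m) (hodd : Odd m) :
    pointCount (hypersurface ((∑ i : Fin (l + 1), X (Fin.castLE (EllipticQuadric.le₁ l) i) *
        X (Fin.rev (Fin.castLE (EllipticQuadric.le₁ l) i))) + X ⟨l + 1, EllipticQuadric.lt₁ l⟩ ^ 2 -
        C ε * X ⟨l + 2, EllipticQuadric.lt₂ l⟩ ^ 2 : MvPolynomial (Fin (2 * l + 2 + 2)) k)) m *
        (Nat.card k ^ m - 1) + 1 + (Nat.card k ^ m) ^ (l + 2) =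
      (Nat.card k ^ m) ^ (2 * l + 3) + (Nat.card k ^ m) ^ (l + 1) := by
  obtain ⟨L, hLfin, hL⟩ := FiniteField.exists_intermediateField_finrank_eq (k := k) hm
  haveI := hLfin
  haveI : Module.Finite k L := Module.Finite.of_finite
  have hQ : Nat.card L = Nat.card k ^ m := by rw [Module.natCard_eq_pow_finrank (K := k) (V := L), hL]
  have hεL : ¬IsSquare (algebraMap k L ε) := fun h =>
    (Nat.not_even_iff_odd.mpr hodd) (hL ▸ (FiniteField.isSquare_algebraMap_iff_even_finrank hε).mp h)
  have hcone := EllipticQuadric.natCard_cone_add l ε L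
  rw [natCard_sq_sub_mul_sq_eq_zero_of_not_isSquare L hεL, one_mul, one_mul,
    ← SmoothHypersurface.pointCount_mul_sub_one_add_one _ (EllipticQuadric.isHomogeneous l ε) two_pos hm L hL] at hcone
  have hI := natCard_pairing_eq_zero L (l + 1)
  have hII := natCard_pairing_eq_zero_add L (p := l + 1)
  rw [Nat.add_sub_cancel] at hI
  rw [← hQ]
  set Q := Nat.card L with hQdef
  set N₀ := Nat.card {w : (Fin (l + 1) → L) × (Fin (l + 1) → L) // ∑ i, w.1 i * w.2 i = 0}
  set N₁ := Nat.card {w : (Fin (l + 1) → L) × (Fin (l + 1) → L) // ∑ i, w.1 i * w.2 i = 1}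
  set P := pointCount (hypersurface ((∑ i : Fin (l + 1), X (Fin.castLE (EllipticQuadric.le₁ l) i) *
        X (Fin.rev (Fin.castLE (EllipticQuadric.le₁ l) i))) + X ⟨l + 1, EllipticQuadric.lt₁ l⟩ ^ 2 -
        C ε * X ⟨l + 2, EllipticQuadric.lt₂ l⟩ ^ 2 : MvPolynomial (Fin (2 * l + 2 + 2)) k)) m
  have h1 : 1 ≤ Q := Nat.card_pos
  have h2 : 1 ≤ Q ^ (l + 1) := Nat.one_le_pow _ _ h1
  zify [h1, h2] at hcone hI hII ⊢
  linear_combination hcone + ((Q : ℤ) + 1) * hII - (Q : ℤ) * hI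

/-- The raw count over `𝔽_{q^m}`, `m` EVEN (so `ε` becomes a square and `E ⊗ 𝔽_{q^m}` is hyperbolic):
`#E(𝔽_Q)·(Q − 1) + 1 + Q^{l+1} = Q^{2l+3} + Q^{l+2}`. [cite: Hirschfeld1998, §5.2 Thm. 5.2.6 (ii), (iii)] -/
theorem pointCount_ellipticQuadric_mul_sub_one_add_of_even (hε : ¬IsSquare ε) {m : ℕ} (hm : 0 < m)
    (heven : Even m) :
    pointCount (hypersurface ((∑ i : Fin (l + 1), X (Fin.castLE (EllipticQuadric.le₁ l) i) *
        X (Fin.rev (Fin.castLE (EllipticQuadric.le₁ l) i))) + X ⟨l + 1, EllipticQuadric.lt₁ l⟩ ^ 2 -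
        C ε * X ⟨l + 2, EllipticQuadric.lt₂ l⟩ ^ 2 : MvPolynomial (Fin (2 * l + 2 + 2)) k)) m *
        (Nat.card k ^ m - 1) + 1 + (Nat.card k ^ m) ^ (l + 1) =
      (Nat.card k ^ m) ^ (2 * l + 3) + (Nat.card k ^ m) ^ (l + 2) := by
  obtain ⟨L, hLfin, hL⟩ := FiniteField.exists_intermediateField_finrank_eq (k := k) hm
  haveI := hLfin
  haveI : Module.Finite k L := Module.Finite.of_finite
  letI := Fintype.ofFinite L
  have hQ : Nat.card L = Nat.card k ^ m := by rw [Module.natCard_eq_pow_finrank (K := k) (V := L), hL]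
  have hk2 : ringChar k ≠ 2 := fun h => hε (FiniteField.isSquare_of_char_two h ε)
  have hL2 : ringChar L ≠ 2 := by rwa [← Algebra.ringChar_eq k L]
  have hε0 : ε ≠ 0 := fun h => hε (h ▸ IsSquare.zero)
  obtain ⟨δ, hδ⟩ : IsSquare (algebraMap k L ε) :=
    (FiniteField.isSquare_algebraMap_iff_even_finrank hε).mpr (hL ▸ heven)
  have hδ0 : δ ≠ 0 := by
    rintro rfl
    rw [mul_zero] at hδ
    exact ((map_ne_zero _).mpr hε0) hδ
  rw [← pow_two] at hδ
  have hcone := EllipticQuadric.natCard_cone_add l ε L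
  rw [hδ, natCard_sq_sub_sq_mul_sq_eq_zero L hL2 hδ0,
    ← SmoothHypersurface.pointCount_mul_sub_one_add_one _ (EllipticQuadric.isHomogeneous l ε) two_pos hm L hL] at hcone
  have hI := natCard_pairing_eq_zero L (l + 1)
  have hII := natCard_pairing_eq_zero_add L (p := l + 1)
  rw [Nat.add_sub_cancel] at hI
  rw [← hQ]
  set Q := Nat.card L with hQdef
  set N₀ := Nat.card {w : (Fin (l + 1) → L) × (Fin (l + 1) → L) // ∑ i, w.1 i * w.2 i = 0}
  set N₁ := Nat.card {w : (Fin (l + 1) → L) × (Fin (l + 1) → L) // ∑ i, w.1 i * w.2 i = 1}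
  set P := pointCount (hypersurface ((∑ i : Fin (l + 1), X (Fin.castLE (EllipticQuadric.le₁ l) i) *
        X (Fin.rev (Fin.castLE (EllipticQuadric.le₁ l) i))) + X ⟨l + 1, EllipticQuadric.lt₁ l⟩ ^ 2 -
        C ε * X ⟨l + 2, EllipticQuadric.lt₂ l⟩ ^ 2 : MvPolynomial (Fin (2 * l + 2 + 2)) k)) m
  have h1 : 1 ≤ Q := Nat.card_pos
  have h2 : 1 ≤ Q ^ (l + 1) := Nat.one_le_pow _ _ h1
  have h3 : 1 ≤ 2 * Q := by omega
  zify [h1, h2, h3] at hcone hI hII ⊢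
  linear_combination hcone + ((Q : ℤ) - 1) * hII + (Q : ℤ) * hI

/-- **Hirschfeld's Theorem 5.2.6 (iii) over the odd-degree extensions: `#E(𝔽_Q) + Q^{l+1} = Σ_{i=0}^{2l+2} Qⁱ`**,
`Q = q^m`, `m` odd — «`ψ₋(2s−1, q) = (qˢ + 1)(q^{s−1} − 1)/(q − 1)`» with `s = l + 2`.
[cite: Hirschfeld1998, §5.2 Thm. 5.2.6 (iii)] -/
theorem pointCount_ellipticQuadric_add_of_odd (hε : ¬IsSquare ε) {m : ℕ} (hm : 0 < m) (hodd : Odd m) :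
    pointCount (hypersurface ((∑ i : Fin (l + 1), X (Fin.castLE (EllipticQuadric.le₁ l) i) *
        X (Fin.rev (Fin.castLE (EllipticQuadric.le₁ l) i))) + X ⟨l + 1, EllipticQuadric.lt₁ l⟩ ^ 2 -
        C ε * X ⟨l + 2, EllipticQuadric.lt₂ l⟩ ^ 2 : MvPolynomial (Fin (2 * l + 2 + 2)) k)) m +
        Nat.card k ^ (m * (l + 1)) =
      ∑ i ∈ range (2 * l + 3), Nat.card k ^ (m * i) := by
  have h := pointCount_ellipticQuadric_mul_sub_one_add_of_odd l hε hm hodd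
  simp_rw [pow_mul]
  set Q := Nat.card k ^ m with hQ
  set P := pointCount (hypersurface ((∑ i : Fin (l + 1), X (Fin.castLE (EllipticQuadric.le₁ l) i) *
        X (Fin.rev (Fin.castLE (EllipticQuadric.le₁ l) i))) + X ⟨l + 1, EllipticQuadric.lt₁ l⟩ ^ 2 -
        C ε * X ⟨l + 2, EllipticQuadric.lt₂ l⟩ ^ 2 : MvPolynomial (Fin (2 * l + 2 + 2)) k)) m
  have hQ1 : 1 < Q := Nat.one_lt_pow hm.ne' Finite.one_lt_card
  have key : (P + Q ^ (l + 1)) * (Q - 1) = (∑ i ∈ range (2 * l + 3), Q ^ i) * (Q - 1) := by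
    zify [hQ1.le] at h ⊢
    have hg : (∑ i ∈ range (2 * l + 3), (Q : ℤ) ^ i) * ((Q : ℤ) - 1) = (Q : ℤ) ^ (2 * l + 3) - 1 :=
      geom_sum_mul _ _
    linear_combination h - hg
  exact Nat.eq_of_mul_eq_mul_right (Nat.sub_pos_of_lt hQ1) key

/-- **Over the even-degree extensions the elliptic quadric counts like the hyperbolic one:
`#E(𝔽_Q) = Σ_{i=0}^{2l+2} Qⁱ + Q^{l+1}`**, `Q = q^m`, `m` even (`ψ₊(2s−1, Q)`).
[cite: Hirschfeld1998, §5.2 Thm. 5.2.6 (ii), (iii)] -/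
theorem pointCount_ellipticQuadric_of_even (hε : ¬IsSquare ε) {m : ℕ} (hm : 0 < m) (heven : Even m) :
    pointCount (hypersurface ((∑ i : Fin (l + 1), X (Fin.castLE (EllipticQuadric.le₁ l) i) *
        X (Fin.rev (Fin.castLE (EllipticQuadric.le₁ l) i))) + X ⟨l + 1, EllipticQuadric.lt₁ l⟩ ^ 2 -
        C ε * X ⟨l + 2, EllipticQuadric.lt₂ l⟩ ^ 2 : MvPolynomial (Fin (2 * l + 2 + 2)) k)) m =
      ∑ i ∈ range (2 * l + 3), Nat.card k ^ (m * i) + Nat.card k ^ (m * (l + 1)) := by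
  have h := pointCount_ellipticQuadric_mul_sub_one_add_of_even l hε hm heven
  simp_rw [pow_mul]
  set Q := Nat.card k ^ m with hQ
  set P := pointCount (hypersurface ((∑ i : Fin (l + 1), X (Fin.castLE (EllipticQuadric.le₁ l) i) *
        X (Fin.rev (Fin.castLE (EllipticQuadric.le₁ l) i))) + X ⟨l + 1, EllipticQuadric.lt₁ l⟩ ^ 2 -
        C ε * X ⟨l + 2, EllipticQuadric.lt₂ l⟩ ^ 2 : MvPolynomial (Fin (2 * l + 2 + 2)) k)) m
  have hQ1 : 1 < Q := Nat.one_lt_pow hm.ne' Finite.one_lt_card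
  have key : P * (Q - 1) = (∑ i ∈ range (2 * l + 3), Q ^ i + Q ^ (l + 1)) * (Q - 1) := by
    zify [hQ1.le] at h ⊢
    have hg : (∑ i ∈ range (2 * l + 3), (Q : ℤ) ^ i) * ((Q : ℤ) - 1) = (Q : ℤ) ^ (2 * l + 3) - 1 :=
      geom_sum_mul _ _
    linear_combination h - hg
  exact Nat.eq_of_mul_eq_mul_right (Nat.sub_pos_of_lt hQ1) key

/-- **`#E(𝔽_{q^m}) = Σ_{i=0}^{2l+2} q^{mi} + (−q^{l+1})^m` for every `m ≥ 1`** — the point counts of the elliptic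
quadric are those of `ℙ^{2l+2}` plus the SIGNED middle term `(−q^{l+1})^m` (an inverse root `−q^{l+1}` of weight
`2l + 2` that is not a power of `q`). [cite: Hirschfeld1998, §5.2 Thm. 5.2.6 (ii), (iii)] [cite: Weil1949, p. 507] -/
theorem pointCount_ellipticQuadric_cast (hε : ¬IsSquare ε) {m : ℕ} (hm : 0 < m) :
    (pointCount (hypersurface ((∑ i : Fin (l + 1), X (Fin.castLE (EllipticQuadric.le₁ l) i) *
        X (Fin.rev (Fin.castLE (EllipticQuadric.le₁ l) i))) + X ⟨l + 1, EllipticQuadric.lt₁ l⟩ ^ 2 -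
        C ε * X ⟨l + 2, EllipticQuadric.lt₂ l⟩ ^ 2 : MvPolynomial (Fin (2 * l + 2 + 2)) k)) m : ℤ) =
      ∑ i ∈ range (2 * l + 3), ((Nat.card k : ℤ) ^ i) ^ m + (-(Nat.card k : ℤ) ^ (l + 1)) ^ m := by
  rcases Nat.even_or_odd m with heven | hodd
  · have h := pointCount_ellipticQuadric_of_even l hε hm heven
    rw [heven.neg_pow, h, Nat.cast_add, Nat.cast_sum]
    simp_rw [Nat.cast_pow, ← pow_mul, mul_comm m]
  · have h := pointCount_ellipticQuadric_add_of_odd l hε hm hodd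
    rw [hodd.neg_pow, ← sub_eq_add_neg, eq_sub_iff_add_eq, ← pow_mul, mul_comm (l + 1)]
    have h' := congrArg (fun n : ℕ => (n : ℤ)) h
    simp only [Nat.cast_add, Nat.cast_sum, Nat.cast_pow] at h'
    simp_rw [← pow_mul, mul_comm _ m]
    exact h'

/-- **Hirschfeld's display: `#E(𝔽_q)·(q − 1) = (q^{l+1} − 1)(q^{l+2} + 1)`** (`ψ₋(2s−1, q)(q−1) = (qˢ+1)(q^{s−1}−1)`,
`s = l + 2`). [cite: Hirschfeld1998, §5.2 Thm. 5.2.6 (iii)] -/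
theorem pointCount_ellipticQuadric_one_mul_sub_one (hε : ¬IsSquare ε) :
    pointCount (hypersurface ((∑ i : Fin (l + 1), X (Fin.castLE (EllipticQuadric.le₁ l) i) *
        X (Fin.rev (Fin.castLE (EllipticQuadric.le₁ l) i))) + X ⟨l + 1, EllipticQuadric.lt₁ l⟩ ^ 2 -
        C ε * X ⟨l + 2, EllipticQuadric.lt₂ l⟩ ^ 2 : MvPolynomial (Fin (2 * l + 2 + 2)) k)) 1 * (Nat.card k - 1) =
      (Nat.card k ^ (l + 1) - 1) * (Nat.card k ^ (l + 2) + 1) := by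
  have h := pointCount_ellipticQuadric_mul_sub_one_add_of_odd l hε one_pos odd_one
  simp only [pow_one] at h
  have h1 : 1 ≤ Nat.card k := Nat.card_pos
  have h2 : 1 ≤ Nat.card k ^ (l + 1) := Nat.one_le_pow _ _ h1
  zify [h1, h2] at h ⊢
  linear_combination h

/-- **The elliptic quadric surface (`l = 0`) is an ovoid: `#E(𝔽_Q) = Q² + 1`** over the odd-degree extensions
(`ψ₋(3, q) = q² + 1`; no lines over `𝔽_q`). [cite: Hirschfeld1998, §5.2 Thm. 5.2.6 (iii)] -/
theorem pointCount_ellipticQuadric_surface_of_odd {ε : k} (hε : ¬IsSquare ε) {m : ℕ} (hm : 0 < m) (hodd : Odd m) :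
    pointCount (hypersurface ((∑ i : Fin (0 + 1), X (Fin.castLE (EllipticQuadric.le₁ 0) i) *
        X (Fin.rev (Fin.castLE (EllipticQuadric.le₁ 0) i))) + X ⟨0 + 1, EllipticQuadric.lt₁ 0⟩ ^ 2 -
        C ε * X ⟨0 + 2, EllipticQuadric.lt₂ 0⟩ ^ 2 : MvPolynomial (Fin (2 * 0 + 2 + 2)) k)) m =
      (Nat.card k ^ m) ^ 2 + 1 := by
  have h := pointCount_ellipticQuadric_add_of_odd 0 hε hm hodd
  set P := pointCount (hypersurface ((∑ i : Fin (0 + 1), X (Fin.castLE (EllipticQuadric.le₁ 0) i) *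
        X (Fin.rev (Fin.castLE (EllipticQuadric.le₁ 0) i))) + X ⟨0 + 1, EllipticQuadric.lt₁ 0⟩ ^ 2 -
        C ε * X ⟨0 + 2, EllipticQuadric.lt₂ 0⟩ ^ 2 : MvPolynomial (Fin (2 * 0 + 2 + 2)) k)) m
  simp only [sum_range_succ, sum_range_zero, mul_zero, pow_zero, mul_one, zero_add, pow_mul, pow_one] at h
  omega

/-- … and `#E(𝔽_Q) = (Q + 1)²` over the even-degree extensions (where it is the hyperbolic quadric `ℙ¹ × ℙ¹`).
[cite: Hirschfeld1998, §5.2 Thm. 5.2.6 (ii)] -/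
theorem pointCount_ellipticQuadric_surface_of_even {ε : k} (hε : ¬IsSquare ε) {m : ℕ} (hm : 0 < m)
    (heven : Even m) :
    pointCount (hypersurface ((∑ i : Fin (0 + 1), X (Fin.castLE (EllipticQuadric.le₁ 0) i) *
        X (Fin.rev (Fin.castLE (EllipticQuadric.le₁ 0) i))) + X ⟨0 + 1, EllipticQuadric.lt₁ 0⟩ ^ 2 -
        C ε * X ⟨0 + 2, EllipticQuadric.lt₂ 0⟩ ^ 2 : MvPolynomial (Fin (2 * 0 + 2 + 2)) k)) m =
      (Nat.card k ^ m + 1) ^ 2 := by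
  rw [pointCount_ellipticQuadric_of_even 0 hε hm heven]
  simp only [sum_range_succ, sum_range_zero, mul_zero, pow_zero, mul_one, zero_add, pow_mul]
  ring

/-- **`Z(E, T) · ∏_{i=0}^{2l+2} (1 − qⁱT) · (1 + q^{l+1}T) = 1`**: the zeta function of the elliptic quadric is
`1/((1−T)(1−qT)⋯(1−q^{2l+2}T)·(1 + q^{l+1}T))` — the extra inverse root is `−q^{l+1}`.
[cite: Weil1949, p. 507] [cite: Hirschfeld1998, §5.2 Thm. 5.2.6 (iii)] -/
theorem zetaSeries_ellipticQuadric_mul_prod (hε : ¬IsSquare ε) :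
    zetaSeries (hypersurface ((∑ i : Fin (l + 1), X (Fin.castLE (EllipticQuadric.le₁ l) i) *
        X (Fin.rev (Fin.castLE (EllipticQuadric.le₁ l) i))) + X ⟨l + 1, EllipticQuadric.lt₁ l⟩ ^ 2 -
        C ε * X ⟨l + 2, EllipticQuadric.lt₂ l⟩ ^ 2 : MvPolynomial (Fin (2 * l + 2 + 2)) k)) *
      ((∏ i ∈ range (2 * l + 3), ((1 - Polynomial.C ((Nat.card k : ℚ) ^ i) * Polynomial.X : Polynomial ℚ) :
        PowerSeries ℚ)) *
        ((1 + Polynomial.C ((Nat.card k : ℚ) ^ (l + 1)) * Polynomial.X : Polynomial ℚ) : PowerSeries ℚ)) = 1 := by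
  have hZ : zetaSeries (hypersurface ((∑ i : Fin (l + 1), X (Fin.castLE (EllipticQuadric.le₁ l) i) *
        X (Fin.rev (Fin.castLE (EllipticQuadric.le₁ l) i))) + X ⟨l + 1, EllipticQuadric.lt₁ l⟩ ^ 2 -
        C ε * X ⟨l + 2, EllipticQuadric.lt₂ l⟩ ^ 2 : MvPolynomial (Fin (2 * l + 2 + 2)) k)) =
      (∏ i ∈ range (2 * l + 3), countZeta (fun m => ((Nat.card k : ℤ) ^ i) ^ m)) *
        countZeta (fun m => (-(Nat.card k : ℤ) ^ (l + 1)) ^ m) := by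
    rw [zetaSeries_eq_countZeta, ← countZeta_sum, ← countZeta_add]
    refine countZeta_congr fun m hm => ?_
    rw [pointCount_ellipticQuadric_cast l hε hm, Pi.add_apply, Finset.sum_apply]
  have hc : ∀ i : ℕ, countZeta (fun m => ((Nat.card k : ℤ) ^ i) ^ m) *
      ((1 - Polynomial.C ((Nat.card k : ℚ) ^ i) * Polynomial.X : Polynomial ℚ) : PowerSeries ℚ) = 1 := by
    intro i
    have h := countZeta_pow_mul ((Nat.card k : ℤ) ^ i)
    rw [Int.cast_pow, Int.cast_natCast] at h
    exact h
  have hneg : countZeta (fun m => (-(Nat.card k : ℤ) ^ (l + 1)) ^ m) *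
      ((1 + Polynomial.C ((Nat.card k : ℚ) ^ (l + 1)) * Polynomial.X : Polynomial ℚ) : PowerSeries ℚ) = 1 := by
    have h := countZeta_pow_mul (-(Nat.card k : ℤ) ^ (l + 1))
    rw [Int.cast_neg, Int.cast_pow, Int.cast_natCast, map_neg, neg_mul, sub_neg_eq_add] at h
    exact h
  rw [hZ, mul_mul_mul_comm, ← prod_mul_distrib, prod_eq_one fun i _ => hc i, one_mul, hneg]

end PointCount

end Literature.AlgebraicGeometry.Motives

/-! ### §5 Pole orders of zeta functions of Tate type (pure algebra) -/

namespace Literature.AlgebraicGeometry.Kahn2003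

open Polynomial

/-- A harmless polynomial factor: if `Z · u` has a pole of order `ρ` at `t₀` and `u(t₀) ≠ 0`, so has `Z`.
[cite: Milne2012AddendumZetaValues, §0.4] -/
theorem HasPoleOfOrderAt.of_mul_coe {Z : PowerSeries ℚ} {u : ℚ[X]} {t₀ : ℚ} {ρ : ℕ} (hu : u.eval t₀ ≠ 0)
    (h : HasPoleOfOrderAt (Z * (u : PowerSeries ℚ)) t₀ ρ) : HasPoleOfOrderAt Z t₀ ρ := by
  obtain ⟨A, B, hA, hB, hZ⟩ := h
  refine ⟨A, u * B, hA, by rw [eval_mul]; exact mul_ne_zero hu hB, ?_⟩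
  rw [← hZ, mul_assoc u, Polynomial.coe_mul, mul_assoc]

/-- **The pole orders of a zeta function of Tate type**: if `Z · ∏_{i ∈ s} (1 − q^{aᵢ}T)^{cᵢ} = 1` (`q > 1`), then
at `T = q^{−r}` the series `Z` has a pole of order EXACTLY `Σ_{aᵢ = r} cᵢ` — the number of inverse roots equal to
`qʳ` (Tate 1965 §3 for cellular varieties: the order of the pole at `q^{−r}` is the number of `r`-cells; Kahn
Conj. 6.52's left-hand side). [cite: TateWoodsHole1965, §3] [cite: Kahn2020, §6.14 Conj. 6.52]
[cite: Milne2012AddendumZetaValues, §0.4] -/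
theorem hasPoleOfOrderAt_of_mul_prod_pow_eq_one {ι : Type*} (s : Finset ι) (a c : ι → ℕ) {q : ℕ}
    (hq : 1 < q) {Z : PowerSeries ℚ} (r : ℕ)
    (hZ : Z * ((∏ i ∈ s, (1 - C ((q : ℚ) ^ a i) * X) ^ c i : ℚ[X]) : PowerSeries ℚ) = 1) :
    HasPoleOfOrderAt Z (((q : ℚ) ^ r)⁻¹) (∑ i ∈ s with a i = r, c i) := by
  classical
  have hq0 : (q : ℚ) ≠ 0 := by exact_mod_cast (zero_lt_one.trans hq).ne'
  have hqr : (q : ℚ) ^ r ≠ 0 := pow_ne_zero _ hq0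
  set t₀ : ℚ := ((q : ℚ) ^ r)⁻¹ with ht₀
  set ρ : ℕ := ∑ i ∈ s with a i = r, c i with hρ
  set B : ℚ[X] := ∏ i ∈ s with ¬a i = r, (1 - C ((q : ℚ) ^ a i) * X) ^ c i with hB
  set κ : ℚ := (-(q : ℚ) ^ r) ^ ρ with hκ
  have hκ0 : κ ≠ 0 := pow_ne_zero _ (neg_ne_zero.mpr hqr)
  -- `1 − qʳT = (−qʳ)·(T − q^{−r})`
  have hlin : (1 - C ((q : ℚ) ^ r) * X : ℚ[X]) = C (-(q : ℚ) ^ r) * (X - C t₀) := by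
    have h1 : C ((q : ℚ) ^ r) * C t₀ = (1 : ℚ[X]) := by rw [← C_mul, ht₀, mul_inv_cancel₀ hqr, C_1]
    rw [C_neg]
    linear_combination -h1
  -- the product splits as `B · κ · (T − t₀)^ρ`
  have hsplit : (∏ i ∈ s, (1 - C ((q : ℚ) ^ a i) * X) ^ c i : ℚ[X]) = B * (C κ * (X - C t₀) ^ ρ) := by
    rw [← Finset.prod_filter_mul_prod_filter_not s (fun i => a i = r), mul_comm, hB]
    congr 1
    rw [Finset.prod_congr rfl (fun i hi => by rw [(Finset.mem_filter.mp hi).2, hlin, mul_pow, ← C_pow] :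
        ∀ i ∈ s.filter (fun i => a i = r), ((1 - C ((q : ℚ) ^ a i) * X) ^ c i : ℚ[X]) =
          C ((-(q : ℚ) ^ r) ^ c i) * (X - C t₀) ^ c i),
      Finset.prod_mul_distrib, ← map_prod C, Finset.prod_pow_eq_pow_sum, Finset.prod_pow_eq_pow_sum, hκ, hρ]
  refine ⟨C κ⁻¹, B, by rw [eval_C]; exact inv_ne_zero hκ0, ?_, ?_⟩
  · -- `B(t₀) ≠ 0`: `q^{aᵢ} q^{−r} ≠ 1` for `aᵢ ≠ r`
    rw [hB, eval_prod]
    refine Finset.prod_ne_zero_iff.mpr fun i hi => ?_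
    have hne : a i ≠ r := (Finset.mem_filter.mp hi).2
    rw [eval_pow]
    refine pow_ne_zero _ ?_
    rw [eval_sub, eval_one, eval_mul, eval_C, eval_X, sub_ne_zero, ne_eq, eq_comm, ht₀, mul_inv_eq_one₀ hqr]
    exact fun h => hne (Nat.pow_right_injective hq (by exact_mod_cast h))
  · -- `Z · (B (T − t₀)^ρ) = κ⁻¹`
    have h1 : Z * ((B * (X - C t₀) ^ ρ : ℚ[X]) : PowerSeries ℚ) * ((C κ : ℚ[X]) : PowerSeries ℚ) = 1 := by
      rw [mul_assoc, ← Polynomial.coe_mul, show B * (X - C t₀) ^ ρ * C κ = B * (C κ * (X - C t₀) ^ ρ) by ring,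
        ← hsplit, hZ]
    have h2 : ((C κ : ℚ[X]) : PowerSeries ℚ) * ((C κ⁻¹ : ℚ[X]) : PowerSeries ℚ) = 1 := by
      rw [← Polynomial.coe_mul, ← C_mul, mul_inv_cancel₀ hκ0, C_1, Polynomial.coe_one]
    calc Z * ((B * (X - C t₀) ^ ρ : ℚ[X]) : PowerSeries ℚ)
        = Z * ((B * (X - C t₀) ^ ρ : ℚ[X]) : PowerSeries ℚ) * (((C κ : ℚ[X]) : PowerSeries ℚ) *
            ((C κ⁻¹ : ℚ[X]) : PowerSeries ℚ)) := by rw [h2, mul_one]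
      _ = ((C κ⁻¹ : ℚ[X]) : PowerSeries ℚ) := by rw [← mul_assoc, h1, one_mul]

end Literature.AlgebraicGeometry.Kahn2003

namespace Literature.AlgebraicGeometry.Motives

/-! ### §6 The Weil factorisation of `Z(E, T)`: `P_{2l+2} = 1 − q^{2l+2}T²`; all poles at the `q^{−r}` are simple -/

section Weil

open Polynomial
open SmoothHypersurface (hypersurface)
open Literature.NumberTheory.LFunctions.WeilFactorization (prod_univ_filter_eq_prod_range_filter)
open Literature.AlgebraicGeometry.Kahn2003 (hasPoleOfOrderAt_of_mul_prod_pow_eq_one)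

variable {k : Type u} [Field k] [Finite k] (l : ℕ) {ε : k}

/-- Re-indexing the even degrees `0, 2, …, 2d` of `Fin (2d+1)` by `r ↦ 2r` (private helper). [folklore] -/
private theorem prod_univ_filter_even_eq_prod_range'' {M : Type*} [CommMonoid M] (d : ℕ) (g : ℕ → M) :
    ∏ i ∈ (Finset.univ : Finset (Fin (2 * d + 1))) with Even i.val, g i.val =
      ∏ r ∈ Finset.range (d + 1), g (2 * r) := by
  rw [prod_univ_filter_eq_prod_range_filter]
  have hset : (Finset.range (2 * d + 1)).filter Even = (Finset.range (d + 1)).image (2 * ·) := by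
    ext i
    simp only [Finset.mem_filter, Finset.mem_range, Finset.mem_image]
    constructor
    · rintro ⟨hi, ⟨r, hr⟩⟩
      exact ⟨r, by omega, by omega⟩
    · rintro ⟨r, hr, rfl⟩
      exact ⟨by omega, even_two_mul r⟩
  rw [hset, Finset.prod_image fun a _ b _ h => by simpa using h]

/-- `((1 − qʳT) ∈ ℤ[T]).map f = 1 − qʳT` (private helper). [folklore] -/
private theorem map_one_sub_C_mul_X'' {F : Type*} [Field F] (f : ℤ →+* F) (q r : ℕ) :
    ((1 - C ((q : ℤ) ^ r) * X : ℤ[X]).map f) = 1 - C ((q : F) ^ r) * X := by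
  rw [Polynomial.map_sub, Polynomial.map_one, Polynomial.map_mul, Polynomial.map_C, Polynomial.map_X, map_pow,
    map_natCast]

/-- `((1 − qᵉT²) ∈ ℤ[T]).map f = 1 − qᵉT²` (private helper). [folklore] -/
private theorem map_one_sub_C_mul_X_sq {F : Type*} [Field F] (f : ℤ →+* F) (q e : ℕ) :
    ((1 - C ((q : ℤ) ^ e) * X ^ 2 : ℤ[X]).map f) = 1 - C ((q : F) ^ e) * X ^ 2 := by
  rw [Polynomial.map_sub, Polynomial.map_one, Polynomial.map_mul, Polynomial.map_C, Polynomial.map_pow,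
    Polynomial.map_X, map_pow, map_natCast]

/-- **The Weil conjectures for the elliptic quadric `E ⊂ ℙ^{2l+3}` over `𝔽_q`** (dimension `2l+2`): `P_{2r} = 1 − qʳT`
for `0 ≤ r ≤ 2l+2`, `r ≠ l+1`, **`P_{2l+2} = 1 − q^{2l+2}T² = (1 − q^{l+1}T)(1 + q^{l+1}T)`**, `P_odd = 1`, is a Weil
factorisation of `Z(E, T)`; the Riemann hypothesis: the roots `±q^{−(l+1)}` of `P_{2l+2}` have absolute value
`q^{−(2l+2)/2}`. [cite: Weil1949, p. 507] [cite: Hirschfeld1998, §5.2 Thm. 5.2.6 (iii)] -/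
theorem isWeilFactorization_ellipticQuadric (hε : ¬IsSquare ε) :
    IsWeilFactorization (Nat.card k) (2 * l + 2) (zetaSeries (hypersurface ((∑ i : Fin (l + 1), MvPolynomial.X (Fin.castLE (EllipticQuadric.le₁ l) i) *
        MvPolynomial.X (Fin.rev (Fin.castLE (EllipticQuadric.le₁ l) i))) +
        MvPolynomial.X ⟨l + 1, EllipticQuadric.lt₁ l⟩ ^ 2 -
        MvPolynomial.C ε * MvPolynomial.X ⟨l + 2, EllipticQuadric.lt₂ l⟩ ^ 2 : MvPolynomial (Fin (2 * l + 2 + 2)) k)))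
      (fun i : Fin (2 * (2 * l + 2) + 1) => if Even (i : ℕ) then
        (if (i : ℕ) / 2 = l + 1 then 1 - C ((Nat.card k : ℤ) ^ (2 * (l + 1))) * X ^ 2
          else 1 - C ((Nat.card k : ℤ) ^ ((i : ℕ) / 2)) * X)
        else 1) := by
  have hq0 : (Nat.card k : ℤ) ≠ 0 := by exact_mod_cast Nat.card_pos.ne'
  refine ⟨fun i => ?_, ?_, ?_, ?_, fun i z hz => ?_⟩
  · -- constant terms
    dsimp only
    split_ifs <;> simp [coeff_zero_eq_eval_zero]
  · -- rationality
    have hodd : ∏ i ∈ (Finset.univ : Finset (Fin (2 * (2 * l + 2) + 1))) with Odd i.val,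
        (((if Even (i : ℕ) then
          (if (i : ℕ) / 2 = l + 1 then 1 - C ((Nat.card k : ℤ) ^ (2 * (l + 1))) * X ^ 2
            else 1 - C ((Nat.card k : ℤ) ^ ((i : ℕ) / 2)) * X)
          else (1 : ℤ[X])).map (Int.castRingHom ℚ) : ℚ[X]) : PowerSeries ℚ) = 1 :=
      Finset.prod_eq_one fun i hi => by
        rw [if_neg (Nat.not_even_iff_odd.mpr (Finset.mem_filter.mp hi).2), Polynomial.map_one,
          Polynomial.coe_one]
    have heven : ∏ i ∈ (Finset.univ : Finset (Fin (2 * (2 * l + 2) + 1))) with Even i.val,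
        (((if Even (i : ℕ) then
          (if (i : ℕ) / 2 = l + 1 then 1 - C ((Nat.card k : ℤ) ^ (2 * (l + 1))) * X ^ 2
            else 1 - C ((Nat.card k : ℤ) ^ ((i : ℕ) / 2)) * X)
          else (1 : ℤ[X])).map (Int.castRingHom ℚ) : ℚ[X]) : PowerSeries ℚ) =
        (∏ r ∈ Finset.range (2 * l + 3), ((1 - C ((Nat.card k : ℚ) ^ r) * X : ℚ[X]) : PowerSeries ℚ)) *
          ((1 + C ((Nat.card k : ℚ) ^ (l + 1)) * X : ℚ[X]) : PowerSeries ℚ) := by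
      rw [prod_univ_filter_even_eq_prod_range'' (2 * l + 2) (fun i => (((if Even i then
          (if i / 2 = l + 1 then 1 - C ((Nat.card k : ℤ) ^ (2 * (l + 1))) * X ^ 2
            else 1 - C ((Nat.card k : ℤ) ^ (i / 2)) * X)
          else (1 : ℤ[X])).map (Int.castRingHom ℚ) : ℚ[X]) : PowerSeries ℚ)),
        show 2 * l + 2 + 1 = 2 * l + 3 from rfl]
      have hfac : ∀ r ∈ Finset.range (2 * l + 3), (((if Even (2 * r) then
          (if 2 * r / 2 = l + 1 then 1 - C ((Nat.card k : ℤ) ^ (2 * (l + 1))) * X ^ 2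
            else 1 - C ((Nat.card k : ℤ) ^ (2 * r / 2)) * X)
          else (1 : ℤ[X])).map (Int.castRingHom ℚ) : ℚ[X]) : PowerSeries ℚ) =
          ((1 - C ((Nat.card k : ℚ) ^ r) * X : ℚ[X]) : PowerSeries ℚ) *
            (if r = l + 1 then ((1 + C ((Nat.card k : ℚ) ^ (l + 1)) * X : ℚ[X]) : PowerSeries ℚ) else 1) := by
        intro r _
        rw [if_pos (even_two_mul r), Nat.mul_div_cancel_left r two_pos]
        split_ifs with h
        · rw [h, map_one_sub_C_mul_X_sq, ← Polynomial.coe_mul]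
          congr 1
          rw [pow_mul, pow_right_comm, map_pow]
          ring
        · rw [map_one_sub_C_mul_X'', mul_one]
      rw [Finset.prod_congr rfl hfac, Finset.prod_mul_distrib, Finset.prod_ite_eq',
        if_pos (Finset.mem_range.mpr (by omega))]
    rw [heven, hodd]
    exact zetaSeries_ellipticQuadric_mul_prod l hε
  · -- `P₀ = 1 − T`
    dsimp only
    rw [if_pos (show Even ((0 : Fin (2 * (2 * l + 2) + 1)) : ℕ) from ⟨0, rfl⟩), Fin.val_zero, Nat.zero_div,
      if_neg (by omega), pow_zero, C_1, one_mul]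
  · -- `P_{4l+4} = 1 − q^{2l+2}T`
    dsimp only
    rw [Fin.val_last, if_pos (even_two_mul (2 * l + 2)), Nat.mul_div_cancel_left (2 * l + 2) two_pos,
      if_neg (by omega)]
  · -- the Riemann hypothesis
    dsimp only at hz
    have hq : (0 : ℝ) ≤ (Nat.card k : ℝ) := Nat.cast_nonneg _
    split_ifs at hz with hi hmid
    · -- the middle degree: roots `±q^{−(l+1)}`
      obtain ⟨r, hr⟩ := hi
      have hir : r = l + 1 := by omega
      subst hir
      rw [map_one_sub_C_mul_X_sq, IsRoot.def, eval_sub, eval_one, eval_mul, eval_C, eval_pow, eval_X,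
        sub_eq_zero] at hz
      have hz2 : z ^ 2 = ((Nat.card k : ℂ) ^ (2 * (l + 1)))⁻¹ := eq_inv_of_mul_eq_one_right hz.symm
      have hn : ‖z‖ ^ 2 = (((Nat.card k : ℝ) ^ (l + 1))⁻¹) ^ 2 := by
        rw [← norm_pow, hz2, norm_inv, norm_pow, Complex.norm_natCast, inv_pow, ← pow_mul, Nat.mul_comm]
      have hnz : ‖z‖ = ((Nat.card k : ℝ) ^ (l + 1))⁻¹ :=
        (pow_left_inj₀ (norm_nonneg _) (inv_nonneg.mpr (pow_nonneg hq _)) two_ne_zero).mp hn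
      rw [hnz, hr, ← Real.rpow_natCast, ← Real.rpow_neg hq]
      congr 1
      push_cast
      ring
    · obtain ⟨r, hr⟩ := hi
      have hir : (i : ℕ) / 2 = r := by omega
      rw [hir, map_one_sub_C_mul_X'', IsRoot.def, eval_sub, eval_one, eval_mul, eval_C, eval_X, sub_eq_zero] at hz
      have hzval : z = ((Nat.card k : ℂ) ^ r)⁻¹ := eq_inv_of_mul_eq_one_right hz.symm
      rw [hzval, norm_inv, norm_pow, Complex.norm_natCast, hr, ← Real.rpow_natCast, ← Real.rpow_neg hq]
      congr 1
      push_cast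
      ring
    · rw [Polynomial.map_one] at hz
      exact absurd hz (by simp)

/-- **Uniqueness**: ANY Weil factorisation of `Z(E, T)` in dimension `2l+2` is the one above (Deligne's weights
separate the `Pᵢ`; the tree's `IsWeilFactorization.unique`). [cite: Deligne1974, Th. (1.6)] [cite: Weil1949, p. 507] -/
theorem IsWeilFactorization.eq_of_ellipticQuadric (hε : ¬IsSquare ε) {P : Fin (2 * (2 * l + 2) + 1) → ℤ[X]}
    (hW : IsWeilFactorization (Nat.card k) (2 * l + 2) (zetaSeries (hypersurface ((∑ i : Fin (l + 1), MvPolynomial.X (Fin.castLE (EllipticQuadric.le₁ l) i) *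
        MvPolynomial.X (Fin.rev (Fin.castLE (EllipticQuadric.le₁ l) i))) +
        MvPolynomial.X ⟨l + 1, EllipticQuadric.lt₁ l⟩ ^ 2 -
        MvPolynomial.C ε * MvPolynomial.X ⟨l + 2, EllipticQuadric.lt₂ l⟩ ^ 2 : MvPolynomial (Fin (2 * l + 2 + 2)) k))) P) :
    P = (fun i : Fin (2 * (2 * l + 2) + 1) => if Even (i : ℕ) then
        (if (i : ℕ) / 2 = l + 1 then 1 - C ((Nat.card k : ℤ) ^ (2 * (l + 1))) * X ^ 2
          else 1 - C ((Nat.card k : ℤ) ^ ((i : ℕ) / 2)) * X)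
        else 1) :=
  hW.unique Finite.one_lt_card (isWeilFactorization_ellipticQuadric l hε)

/-- **The Betti numbers of the elliptic quadric: `b_{2r} = 1` (`r ≠ l+1`), `b_{2l+2} = 2`, `b_odd = 0`** — the same as
for the hyperbolic quadric (two rulings over `𝔽̄_q`), for any Weil factorisation. [cite: Weil1949, p. 507]
[cite: Hirschfeld1998, §5.2 Thm. 5.2.6] -/
theorem IsWeilFactorization.natDegree_eq_of_ellipticQuadric (hε : ¬IsSquare ε)
    {P : Fin (2 * (2 * l + 2) + 1) → ℤ[X]}
    (hW : IsWeilFactorization (Nat.card k) (2 * l + 2) (zetaSeries (hypersurface ((∑ i : Fin (l + 1), MvPolynomial.X (Fin.castLE (EllipticQuadric.le₁ l) i) *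
        MvPolynomial.X (Fin.rev (Fin.castLE (EllipticQuadric.le₁ l) i))) +
        MvPolynomial.X ⟨l + 1, EllipticQuadric.lt₁ l⟩ ^ 2 -
        MvPolynomial.C ε * MvPolynomial.X ⟨l + 2, EllipticQuadric.lt₂ l⟩ ^ 2 : MvPolynomial (Fin (2 * l + 2 + 2)) k))) P)
    (i : Fin (2 * (2 * l + 2) + 1)) :
    (P i).natDegree = if Even (i : ℕ) then (if (i : ℕ) / 2 = l + 1 then 2 else 1) else 0 := by
  have hq0 : (Nat.card k : ℤ) ≠ 0 := by exact_mod_cast Nat.card_pos.ne'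
  rw [hW.eq_of_ellipticQuadric l hε]
  dsimp only
  split_ifs with h1 h2
  · rw [sub_eq_add_neg, add_comm, natDegree_add_eq_left_of_natDegree_lt, natDegree_neg,
      natDegree_C_mul_X_pow 2 _ (pow_ne_zero _ hq0)]
    rw [natDegree_neg, natDegree_C_mul_X_pow 2 _ (pow_ne_zero _ hq0), natDegree_one]
    exact two_pos
  · rw [sub_eq_add_neg, add_comm, natDegree_add_eq_left_of_natDegree_lt, natDegree_neg,
      natDegree_C_mul_X _ (pow_ne_zero _ hq0)]
    rw [natDegree_neg, natDegree_C_mul_X _ (pow_ne_zero _ hq0), natDegree_one]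
    exact one_pos
  · exact natDegree_one

/-- **`b_{2l+2}(E) = 2`** for any Weil factorisation of `Z(E, T)` (middle dimension). [cite: Weil1949, p. 507]
[cite: Hirschfeld1998, §5.2 Thm. 5.2.6] -/
theorem IsWeilFactorization.natDegree_middle_of_ellipticQuadric (hε : ¬IsSquare ε)
    {P : Fin (2 * (2 * l + 2) + 1) → ℤ[X]}
    (hW : IsWeilFactorization (Nat.card k) (2 * l + 2) (zetaSeries (hypersurface ((∑ i : Fin (l + 1), MvPolynomial.X (Fin.castLE (EllipticQuadric.le₁ l) i) *
        MvPolynomial.X (Fin.rev (Fin.castLE (EllipticQuadric.le₁ l) i))) +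
        MvPolynomial.X ⟨l + 1, EllipticQuadric.lt₁ l⟩ ^ 2 -
        MvPolynomial.C ε * MvPolynomial.X ⟨l + 2, EllipticQuadric.lt₂ l⟩ ^ 2 : MvPolynomial (Fin (2 * l + 2 + 2)) k))) P) :
    (P ⟨2 * (l + 1), by omega⟩).natDegree = 2 := by
  rw [hW.natDegree_eq_of_ellipticQuadric l hε, if_pos (even_two_mul _), Nat.mul_div_cancel_left _ two_pos, if_pos rfl]

/-- **All poles of `Z(E, T)` at the points `T = q^{−r}`, `0 ≤ r ≤ 2l+2`, are SIMPLE — including the middle one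
`r = l+1`, although `b_{2l+2}(E) = 2`**: the second inverse root of weight `2l+2` is `−q^{l+1}`, not `q^{l+1}`
(Tate 1965 §3: over `𝔽_q` only ONE ruling class of the elliptic quadric is rational — the rank of the
`(l+1)`-cycles is `1`; Kahn Conj. 6.52's left-hand side for `(E, l+1)` is `1`).
[cite: TateWoodsHole1965, §3] [cite: Kahn2020, §6.14 Conj. 6.52] [cite: Hirschfeld1998, §5.2 Thm. 5.2.6 (iii)] -/
theorem hasPoleOfOrderAt_zetaSeries_ellipticQuadric (hε : ¬IsSquare ε) {r : ℕ} (hr : r ≤ 2 * l + 2) :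
    HasPoleOfOrderAt (zetaSeries (hypersurface ((∑ i : Fin (l + 1), MvPolynomial.X (Fin.castLE (EllipticQuadric.le₁ l) i) *
        MvPolynomial.X (Fin.rev (Fin.castLE (EllipticQuadric.le₁ l) i))) +
        MvPolynomial.X ⟨l + 1, EllipticQuadric.lt₁ l⟩ ^ 2 -
        MvPolynomial.C ε * MvPolynomial.X ⟨l + 2, EllipticQuadric.lt₂ l⟩ ^ 2 : MvPolynomial (Fin (2 * l + 2 + 2)) k))) (((Nat.card k : ℚ) ^ r)⁻¹) 1 := by
  have hZ := zetaSeries_ellipticQuadric_mul_prod l hε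
  -- `Z · (1 + q^{l+1}T)` is of Tate type
  have hprod : (∏ i ∈ Finset.range (2 * l + 3), ((1 - C ((Nat.card k : ℚ) ^ i) * X : ℚ[X]) : PowerSeries ℚ)) =
      ((∏ i ∈ Finset.range (2 * l + 3), (1 - C ((Nat.card k : ℚ) ^ i) * X) ^ 1 : ℚ[X]) : PowerSeries ℚ) := by
    rw [← Polynomial.coeToPowerSeries.ringHom_apply, map_prod]
    refine Finset.prod_congr rfl fun i _ => ?_
    rw [Polynomial.coeToPowerSeries.ringHom_apply, pow_one]
  have hT : zetaSeries (hypersurface ((∑ i : Fin (l + 1), MvPolynomial.X (Fin.castLE (EllipticQuadric.le₁ l) i) *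
        MvPolynomial.X (Fin.rev (Fin.castLE (EllipticQuadric.le₁ l) i))) +
        MvPolynomial.X ⟨l + 1, EllipticQuadric.lt₁ l⟩ ^ 2 -
        MvPolynomial.C ε * MvPolynomial.X ⟨l + 2, EllipticQuadric.lt₂ l⟩ ^ 2 : MvPolynomial (Fin (2 * l + 2 + 2)) k)) * ((1 + C ((Nat.card k : ℚ) ^ (l + 1)) * X : ℚ[X]) : PowerSeries ℚ) *
      ((∏ i ∈ Finset.range (2 * l + 3), (1 - C ((Nat.card k : ℚ) ^ i) * X) ^ 1 : ℚ[X]) : PowerSeries ℚ) = 1 := by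
    rw [← hprod, mul_assoc, mul_comm (((1 + C ((Nat.card k : ℚ) ^ (l + 1)) * X : ℚ[X]) : PowerSeries ℚ)), hZ]
  have h := hasPoleOfOrderAt_of_mul_prod_pow_eq_one (Finset.range (2 * l + 3)) (fun i => i) (fun _ => 1)
    Finite.one_lt_card r hT
  simp only [Finset.sum_const, smul_eq_mul, mul_one, Finset.filter_eq', Finset.mem_range,
    show r < 2 * l + 3 by omega, if_true, Finset.card_singleton] at h
  refine h.of_mul_coe ?_
  rw [eval_add, eval_one, eval_mul, eval_C, eval_X]
  positivity

/-- In particular `Z(E, T)` has a SIMPLE pole at `T = q^{−(l+1)}` (rank one in the middle dimension over `𝔽_q`).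
[cite: TateWoodsHole1965, §3] [cite: Kahn2020, §6.14 Conj. 6.52] -/
theorem hasPoleOfOrderAt_zetaSeries_ellipticQuadric_middle (hε : ¬IsSquare ε) :
    HasPoleOfOrderAt (zetaSeries (hypersurface ((∑ i : Fin (l + 1), MvPolynomial.X (Fin.castLE (EllipticQuadric.le₁ l) i) *
        MvPolynomial.X (Fin.rev (Fin.castLE (EllipticQuadric.le₁ l) i))) +
        MvPolynomial.X ⟨l + 1, EllipticQuadric.lt₁ l⟩ ^ 2 -
        MvPolynomial.C ε * MvPolynomial.X ⟨l + 2, EllipticQuadric.lt₂ l⟩ ^ 2 : MvPolynomial (Fin (2 * l + 2 + 2)) k))) (((Nat.card k : ℚ) ^ (l + 1))⁻¹) 1 :=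
  hasPoleOfOrderAt_zetaSeries_ellipticQuadric l hε (by omega)

end Weil

/-! ### §7 Base change to `𝔽_{q²}`: `E ⊗ 𝔽_{q²}` is hyperbolic and the middle pole becomes DOUBLE -/

section BaseChange

open Polynomial
open SmoothHypersurface (hypersurface)
open Literature.AlgebraicGeometry.Kahn2003 (hasPoleOfOrderAt_of_mul_prod_pow_eq_one)

variable {k : Type u} [Field k] [Finite k] (l : ℕ) {ε : k}

/-- **`Z(E ⊗ 𝔽_{q²}, T) · ∏_{i=0}^{2l+2} (1 − q^{2i}T) · (1 − q^{2(l+1)}T) = 1`**: over `𝔽_{q²}` (the tree's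
`zetaSeriesPow E 2`, built from the counts `#E(𝔽_{q^{2s}})`) the elliptic quadric has the zeta function of the
HYPERBOLIC quadric over `𝔽_{q²}` — `ε` has become a square. [cite: Hirschfeld1998, §5.2 Thm. 5.2.6 (ii), (iii)]
[cite: Stichtenoth2009, Theorem 5.1.15 (f)] -/
theorem zetaSeriesPow_ellipticQuadric_two_mul_prod (hε : ¬IsSquare ε) :
    zetaSeriesPow (hypersurface ((∑ i : Fin (l + 1), MvPolynomial.X (Fin.castLE (EllipticQuadric.le₁ l) i) *
        MvPolynomial.X (Fin.rev (Fin.castLE (EllipticQuadric.le₁ l) i))) +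
        MvPolynomial.X ⟨l + 1, EllipticQuadric.lt₁ l⟩ ^ 2 -
        MvPolynomial.C ε * MvPolynomial.X ⟨l + 2, EllipticQuadric.lt₂ l⟩ ^ 2 : MvPolynomial (Fin (2 * l + 2 + 2)) k)) 2 *
      ((∏ i ∈ Finset.range (2 * l + 3), ((1 - C (((Nat.card k : ℚ) ^ 2) ^ i) * X : ℚ[X]) : PowerSeries ℚ)) *
        ((1 - C (((Nat.card k : ℚ) ^ 2) ^ (l + 1)) * X : ℚ[X]) : PowerSeries ℚ)) = 1 := by
  have hZ : zetaSeriesPow (hypersurface ((∑ i : Fin (l + 1), MvPolynomial.X (Fin.castLE (EllipticQuadric.le₁ l) i) *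
        MvPolynomial.X (Fin.rev (Fin.castLE (EllipticQuadric.le₁ l) i))) +
        MvPolynomial.X ⟨l + 1, EllipticQuadric.lt₁ l⟩ ^ 2 -
        MvPolynomial.C ε * MvPolynomial.X ⟨l + 2, EllipticQuadric.lt₂ l⟩ ^ 2 : MvPolynomial (Fin (2 * l + 2 + 2)) k)) 2 =
      (∏ i ∈ Finset.range (2 * l + 3), countZeta (fun m => (((Nat.card k : ℤ) ^ 2) ^ i) ^ m)) *
        countZeta (fun m => (((Nat.card k : ℤ) ^ 2) ^ (l + 1)) ^ m) := by
    rw [zetaSeriesPow_eq_countZeta, ← countZeta_sum, ← countZeta_add]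
    refine countZeta_congr fun m hm => ?_
    rw [pointCount_ellipticQuadric_of_even l hε (by omega) (even_two_mul m), Pi.add_apply, Finset.sum_apply,
      Nat.cast_add, Nat.cast_sum]
    congr 1
    · exact Finset.sum_congr rfl fun i _ => by rw [Nat.cast_pow, ← pow_mul, ← pow_mul]; ring
    · rw [Nat.cast_pow, ← pow_mul, ← pow_mul]; ring
  have hc : ∀ i : ℕ, countZeta (fun m => (((Nat.card k : ℤ) ^ 2) ^ i) ^ m) *
      ((1 - C (((Nat.card k : ℚ) ^ 2) ^ i) * X : ℚ[X]) : PowerSeries ℚ) = 1 := by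
    intro i
    have h := countZeta_pow_mul (((Nat.card k : ℤ) ^ 2) ^ i)
    rw [Int.cast_pow, Int.cast_pow, Int.cast_natCast] at h
    exact h
  rw [hZ, mul_mul_mul_comm, ← Finset.prod_mul_distrib, Finset.prod_eq_one fun i _ => hc i, one_mul, hc]

/-- **`Z(E ⊗ 𝔽_{q²}, T) = Z(H ⊗ 𝔽_{q²}, T)`** for the hyperbolic quadric `H = V₊(Σ_{i ≤ l+1} ε′ᵢ xᵢ x_{2l+3−i})` in the
same `ℙ^{2l+3}` (`Motives/SplitQuadricPointCount`): the two quadrics have the same point counts over every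
`𝔽_{q^{2s}}` — they become isomorphic over `𝔽_{q²}`. [cite: Hirschfeld1998, §5.2 Thm. 5.2.6 (ii), (iii)] -/
theorem zetaSeriesPow_ellipticQuadric_two_eq_splitQuadric (hε : ¬IsSquare ε) (ε' : Fin (l + 2) → kˣ) :
    zetaSeriesPow (hypersurface ((∑ i : Fin (l + 1), MvPolynomial.X (Fin.castLE (EllipticQuadric.le₁ l) i) *
        MvPolynomial.X (Fin.rev (Fin.castLE (EllipticQuadric.le₁ l) i))) +
        MvPolynomial.X ⟨l + 1, EllipticQuadric.lt₁ l⟩ ^ 2 -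
        MvPolynomial.C ε * MvPolynomial.X ⟨l + 2, EllipticQuadric.lt₂ l⟩ ^ 2 : MvPolynomial (Fin (2 * l + 2 + 2)) k)) 2 =
      zetaSeriesPow (hypersurface (∑ i : Fin (l + 2), MvPolynomial.C (ε' i : k) *
        MvPolynomial.X (Fin.castLE (show l + 2 ≤ 2 * l + 2 + 2 by omega) i) *
        MvPolynomial.X (Fin.rev (Fin.castLE (show l + 2 ≤ 2 * l + 2 + 2 by omega) i)) :
          MvPolynomial (Fin (2 * l + 2 + 2)) k)) 2 := by
  rw [zetaSeriesPow_eq_countZeta, zetaSeriesPow_eq_countZeta]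
  refine countZeta_congr fun m hm => ?_
  rw [pointCount_ellipticQuadric_of_even l hε (by omega) (even_two_mul m), pointCount_splitQuadric l ε' (by omega)]

/-- **Over `𝔽_{q²}` the middle pole is DOUBLE: `Z(E ⊗ 𝔽_{q²}, T)` has a pole of order exactly `2` at
`T = (q²)^{−(l+1)}`** — both ruling classes are rational over `𝔽_{q²}` (Tate 1965 §3: the rank of the `(l+1)`-cycles
jumps from `1` to `2`; the inverse roots `±q^{l+1}` of `P_{2l+2}(E, T)` both square to `(q²)^{l+1}`).
[cite: TateWoodsHole1965, §3] [cite: Kahn2020, §6.14 Conj. 6.52] [cite: Hirschfeld1998, §5.2 Thm. 5.2.6 (ii)] -/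
theorem hasPoleOfOrderAt_zetaSeriesPow_ellipticQuadric_two_middle (hε : ¬IsSquare ε) :
    HasPoleOfOrderAt (zetaSeriesPow (hypersurface ((∑ i : Fin (l + 1), MvPolynomial.X (Fin.castLE (EllipticQuadric.le₁ l) i) *
        MvPolynomial.X (Fin.rev (Fin.castLE (EllipticQuadric.le₁ l) i))) +
        MvPolynomial.X ⟨l + 1, EllipticQuadric.lt₁ l⟩ ^ 2 -
        MvPolynomial.C ε * MvPolynomial.X ⟨l + 2, EllipticQuadric.lt₂ l⟩ ^ 2 : MvPolynomial (Fin (2 * l + 2 + 2)) k)) 2) ((((Nat.card k : ℚ) ^ 2) ^ (l + 1))⁻¹) 2 := by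
  have hZ := zetaSeriesPow_ellipticQuadric_two_mul_prod l hε
  have hq2 : 1 < Nat.card k ^ 2 := Nat.one_lt_pow two_ne_zero Finite.one_lt_card
  -- the product as `∏ (1 − (q²)ⁱT)^{cᵢ}`, `c_{l+1} = 2`
  have hprod : (∏ i ∈ Finset.range (2 * l + 3), ((1 - C (((Nat.card k : ℚ) ^ 2) ^ i) * X : ℚ[X]) : PowerSeries ℚ)) *
      ((1 - C (((Nat.card k : ℚ) ^ 2) ^ (l + 1)) * X : ℚ[X]) : PowerSeries ℚ) =
      ((∏ i ∈ Finset.range (2 * l + 3), (1 - C ((((Nat.card k ^ 2 : ℕ) : ℚ)) ^ i) * X) ^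
        (if i = l + 1 then 2 else 1) : ℚ[X]) : PowerSeries ℚ) := by
    have hpoly : (∏ i ∈ Finset.range (2 * l + 3), (1 - C ((((Nat.card k ^ 2 : ℕ) : ℚ)) ^ i) * X) ^
        (if i = l + 1 then 2 else 1) : ℚ[X]) =
        (∏ i ∈ Finset.range (2 * l + 3), (1 - C (((Nat.card k : ℚ) ^ 2) ^ i) * X)) *
          (1 - C (((Nat.card k : ℚ) ^ 2) ^ (l + 1)) * X) := by
      rw [Nat.cast_pow, Finset.prod_congr rfl (fun i _ => (by
          split_ifs with h
          · rw [h, pow_two]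
          · rw [pow_one, mul_one]) :
          ∀ i ∈ Finset.range (2 * l + 3), ((1 - C (((Nat.card k : ℚ) ^ 2) ^ i) * X) ^ (if i = l + 1 then 2 else 1) :
            ℚ[X]) = (1 - C (((Nat.card k : ℚ) ^ 2) ^ i) * X) *
              (if i = l + 1 then (1 - C (((Nat.card k : ℚ) ^ 2) ^ (l + 1)) * X) else 1)),
        Finset.prod_mul_distrib, Finset.prod_ite_eq', if_pos (Finset.mem_range.mpr (by omega))]
    rw [hpoly, Polynomial.coe_mul]
    congr 1
    symm
    rw [← Polynomial.coeToPowerSeries.ringHom_apply, map_prod]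
    exact Finset.prod_congr rfl fun i _ => by rw [Polynomial.coeToPowerSeries.ringHom_apply]
  rw [hprod] at hZ
  have h := hasPoleOfOrderAt_of_mul_prod_pow_eq_one (Finset.range (2 * l + 3)) (fun i => i)
    (fun i => if i = l + 1 then 2 else 1) hq2 (l + 1) hZ
  simp only [Finset.filter_eq', Finset.mem_range, show l + 1 < 2 * l + 3 by omega, if_true,
    Finset.sum_singleton, Nat.cast_pow] at h
  exact h

/-- Off the middle the poles of `Z(E ⊗ 𝔽_{q²}, T)` at `(q²)^{−r}` stay simple (`r ≤ 2l+2`, `r ≠ l+1`).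
[cite: TateWoodsHole1965, §3] [cite: Weil1949, p. 507] -/
theorem hasPoleOfOrderAt_zetaSeriesPow_ellipticQuadric_two_of_ne (hε : ¬IsSquare ε) {r : ℕ} (hr : r ≤ 2 * l + 2)
    (hne : r ≠ l + 1) :
    HasPoleOfOrderAt (zetaSeriesPow (hypersurface ((∑ i : Fin (l + 1), MvPolynomial.X (Fin.castLE (EllipticQuadric.le₁ l) i) *
        MvPolynomial.X (Fin.rev (Fin.castLE (EllipticQuadric.le₁ l) i))) +
        MvPolynomial.X ⟨l + 1, EllipticQuadric.lt₁ l⟩ ^ 2 -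
        MvPolynomial.C ε * MvPolynomial.X ⟨l + 2, EllipticQuadric.lt₂ l⟩ ^ 2 : MvPolynomial (Fin (2 * l + 2 + 2)) k)) 2) ((((Nat.card k : ℚ) ^ 2) ^ r)⁻¹) 1 := by
  have hZ := zetaSeriesPow_ellipticQuadric_two_mul_prod l hε
  have hq2 : 1 < Nat.card k ^ 2 := Nat.one_lt_pow two_ne_zero Finite.one_lt_card
  have hprod : (∏ i ∈ Finset.range (2 * l + 3), ((1 - C (((Nat.card k : ℚ) ^ 2) ^ i) * X : ℚ[X]) : PowerSeries ℚ)) =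
      ((∏ i ∈ Finset.range (2 * l + 3), (1 - C ((((Nat.card k ^ 2 : ℕ) : ℚ)) ^ i) * X) ^ 1 : ℚ[X]) :
        PowerSeries ℚ) := by
    rw [← Polynomial.coeToPowerSeries.ringHom_apply, map_prod]
    refine Finset.prod_congr rfl fun i _ => ?_
    rw [Polynomial.coeToPowerSeries.ringHom_apply, pow_one, Nat.cast_pow]
  have hT : zetaSeriesPow (hypersurface ((∑ i : Fin (l + 1), MvPolynomial.X (Fin.castLE (EllipticQuadric.le₁ l) i) *
        MvPolynomial.X (Fin.rev (Fin.castLE (EllipticQuadric.le₁ l) i))) +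
        MvPolynomial.X ⟨l + 1, EllipticQuadric.lt₁ l⟩ ^ 2 -
        MvPolynomial.C ε * MvPolynomial.X ⟨l + 2, EllipticQuadric.lt₂ l⟩ ^ 2 : MvPolynomial (Fin (2 * l + 2 + 2)) k)) 2 *
      ((1 - C (((Nat.card k : ℚ) ^ 2) ^ (l + 1)) * X : ℚ[X]) : PowerSeries ℚ) *
      ((∏ i ∈ Finset.range (2 * l + 3), (1 - C ((((Nat.card k ^ 2 : ℕ) : ℚ)) ^ i) * X) ^ 1 : ℚ[X]) :
        PowerSeries ℚ) = 1 := by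
    rw [← hprod, mul_assoc, mul_comm (((1 - C (((Nat.card k : ℚ) ^ 2) ^ (l + 1)) * X : ℚ[X]) : PowerSeries ℚ)), hZ]
  have h := hasPoleOfOrderAt_of_mul_prod_pow_eq_one (Finset.range (2 * l + 3)) (fun i => i) (fun _ => 1) hq2 r hT
  simp only [Finset.sum_const, smul_eq_mul, mul_one, Finset.filter_eq', Finset.mem_range,
    show r < 2 * l + 3 by omega, if_true, Finset.card_singleton, Nat.cast_pow] at h
  refine h.of_mul_coe ?_
  rw [eval_sub, eval_one, eval_mul, eval_C, eval_X, sub_ne_zero, ne_eq, eq_comm,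
    mul_inv_eq_one₀ (pow_ne_zero _ (pow_ne_zero _ (Nat.cast_ne_zero.mpr Nat.card_pos.ne')))]
  intro h'
  have h'' : (Nat.card k ^ 2) ^ (l + 1) = (Nat.card k ^ 2) ^ r := by exact_mod_cast h'
  exact hne (Nat.pow_right_injective hq2 h'').symm

end BaseChange

end Literature.AlgebraicGeometry.Motives

end
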